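import Literature.NumberTheory.GaloisRepresentations.PstWeilDeligneCyclotomicWeight
import Literature.NumberTheory.GaloisRepresentations.PstWeilDeligneCyclotomicPowersWeights
import Literature.NumberTheory.GaloisRepresentations.PstWeilDeligneCrystallineDetOnInertia
import Literature.NumberTheory.GaloisRepresentations.PstWeilDeligneFontaineLaffaille
import Literature.NumberTheory.GaloisRepresentations.CrystallineDeformationRingSmoothProofs
import Literature.NumberTheory.GaloisRepresentations.PadicAlgebraOfLocalField
import Literature.NumberTheory.GaloisRepresentations.PstCrystallineExtensionData
import Literature.NumberTheory.GaloisRepresentations.OrdinaryRegular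
import Literature.NumberTheory.PAdicHodge.BdRDataNonempty
import Literature.NumberTheory.PAdicHodge.BdRFiniteImage
import HarnessLib

/-!
# Fontaine's `p`-adic Hodge datum `(B_dR(F), WD ∘ D_pst)` — the PINNED datum of the summit `Langlands`

Topic `Literature/NumberTheory/PAdicHodge`. Human ruling D-0018 L2 (2026-08-16, statement audit
AMBER-4): the `p`-adic Hodge datum at the places `v ∣ ℓ` in the summit statement `Langlands` is
no longer chosen by the prover (`∃ 𝓡, … 𝓡.pst ℓ v hv : PstWeilDeligneData (K_v) ℓ` with the period
ring `𝔅` and the relation `IsWeilDeligneOf` FIELDS of the datum) but is THE fixed datum of the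
literature: Fontaine's de Rham period ring `B_dR(F)` (Fontaine 1994, Exposé II §1.5, Exposé III
§1.5, §3: `ρ` is de Rham iff `dim_F (B_dR ⊗_{ℚ_ℓ} ρ)^{Γ_F} = dim ρ`) together with the
Weil–Deligne representation `WD(ρ) = WD(D_pst(ρ))` that Fontaine attaches to a potentially
semistable — equivalently (Berger 2002, Thm. 0.7) de Rham — `ℓ`-adic representation `ρ` of
`Γ_F`, `F/ℚ_ℓ` finite, through the filtered `(φ, N, Gal(F'/F))`-module
`D_pst(ρ) = ⋃_{F'} (B_st ⊗_{ℚ_ℓ} ρ)^{Γ_{F'}}` (Fontaine 1994, Exposé VIII §1.3, §2.3.7; Deligne's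
dictionary between `(φ, N)` and Weil–Deligne representations, Tate 1979 (4.1.3), (4.2.1);
Taylor 2004 §1 pp. 79–80; Buzzard–Gee 2014 §2.2).

## What "pinned" means here, precisely

Neither Mathlib (pin v4.32.0: `Mathlib/RingTheory/Perfectoid/BDeRham.lean` has `BDeRham R p` as a
bare ring — no `Γ_F`-action, no filtration, DVR/domain listed as TODO) nor the accepted tree has a
CONSTRUCTION of `B_dR(F)` as a `PeriodRingData`, of `B_st`, of `D_pst`, or of `WD ∘ D_pst` (gap
analysis of the definition item `defn-FontainePstWeilDeligneData`, 2026-08-15: an XL theory —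
Ax–Sen–Tate for `B_dR^{Γ_F} = F`, Berger's theorem for the existence axiom, Fontaine Exposé VIII
for the recipe). The datum is therefore pinned BY SPECIFICATION, in the standard way one names
"the" object of a theorem before its construction is formalised:

* `IsFontaineDatum hℓ 𝔇` — the CHARACTERISING CLAUSES of Fontaine's datum that the accepted tree
  can already phrase, every one a theorem of the literature for `(B_dR(F), WD ∘ D_pst)`:
  (F1) the `ℚ_ℓ`-algebra structure on `F` is the CANONICAL one (accepted
  `LocalField.padicAlgebra F ℓ hℓ`, the unique ring homomorphism `ℚ_ℓ → F` mapping `ℤ_ℓ` into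
  `𝒪_F`; Serre, *Local Fields* II §5) — no longer a datum;
  (F2) the cyclotomic character is de Rham of Hodge–Tate weight `-1` (accepted
  `PstWeilDeligneData.CyclotomicWeightNegOne`; Fontaine Exposé III §1.5, `t⁻¹ ∈ Fil⁻¹ ∖ Fil⁰`;
  Tate 1967) — the NON-TRUNCATION clause: the accepted truncated model
  `unramifiedPstWeilDeligneData F ℓ` (`B = F̂_nr = (B_dR)^{I_F}`, "de Rham" = unramified)
  violates it (accepted `not_cyclotomicWeightNegOne_unramifiedPstWeilDeligneData`), see
  `IsFontaineDatum.ne_unramifiedPstWeilDeligneData`;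
  (F3) unramified representations are de Rham with all Hodge–Tate weights `0` (accepted
  `PstWeilDeligneData.UnramifiedWeightsZero`; Fontaine Exposé III §5: unramified ⇒ crystalline
  with `Fil⁰ D = D`, `Fil¹ D = 0`) — excludes data whose filtration is shifted or whose
  admissible class misses the unramified representations;
  (F4) the cyclotomic character is CRYSTALLINE in the `D_pst` phrasing (accepted
  `PstWeilDeligneData.IsCrystallineFramed`: de Rham, `WD` unramified with `N = 0`; Fontaine
  Exposé VIII §1.3, §2.3.7: `ℚ_ℓ(1)` is crystalline, `D_cris(ℚ_ℓ(1)) = F₀ · t⁻¹`) — a clause on the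
  Weil–Deligne half of the datum beyond the five structure axioms of `PstWeilDeligneData`;
  (F5)–(F7) KISIN'S THEOREMS on crystalline deformation rings (clause addition of 2026-08-16,
  the first use of the "Upgrade path" below; the accepted predicates of
  `CrystallineDeformationRing(Smooth)`, which that file's docstrings assert "of the genuine
  datum"): (F5) `PstWeilDeligneData.HasCrystallineDeformationRings` — the reduced `ℓ`-torsion-free
  quotient of `R^□_{𝒪_L,ρ̄}` whose `ℚ̄_ℓ`-points are the crystalline lifts with Hodge–Tate weights
  in `[a, b]` exists whenever such a lift exists (Kisin 2008, Theorem of the Introduction, Thm.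
  (2.5.5), Cor. (2.7.7), (3.3.3); formulation of [BLGGT] §1.2–1.4); (F6)
  `PstWeilDeligneData.HasHodgeTypeCrystallineDeformationRings` — the same for every labelled Hodge
  type `{v_τ}` and `L ⊇ τ(F)` ([BLGGT] §1.4 `R^□_{𝒪,ρ̄,{H_τ},cris}` = Kisin's `R^{□,v}_{cr}`,
  (3.3.3) with Cor. (2.7.7)); (F7) `PstWeilDeligneData.CrystallineGenericFibreRegular` — Kisin
  Thm. (3.3.8): "`Spec (R^□_{V_𝔽}[1/p])^{τ,v}_{cr}` is formally smooth and equi-dimensional of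
  dimension `d² + dim_E adD_{E,K}/Fil⁰ adD_{E,K}`" (`R[1/ℓ]` regular, every irreducible component
  of dimension `n² + Σ_τ dim GL_n/P_{v_τ}`). WHY these clauses: the accepted `∃`-facts
  `CrystallineDeformationRing.nonempty` and `Kisin2007_crystallineDeformationRings`
  (`∀ K p alg, ∃ 𝔇, 𝔇.algebra = alg ∧ …`) let the prover choose the datum, and the truncated model
  meets their deformation-ring conjuncts up to Mazur's smooth unramified framed ring `𝒪_L⟦X_ij⟧`
  (accepted `unramifiedPstWeilDeligneData_hasCrystallineDeformationRings`,
  `unramifiedPstWeilDeligneData_hasHodgeTypeCrystallineDeformationRings`; review of p61421: "fake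
  progress"), so those facts do not pin Kisin's theorems (verdict `misstated` of the discharge unit
  of `Kisin2007_crystallineDeformationRings`, 2026-08-16); as clauses of the specification they are
  predicated of THE datum, and the `∃`-facts become corollaries of `FontaineDatumExists`
  (`Literature/NumberTheory/GaloisRepresentations/CrystallineDeformationRingsPinned`). The [BLGGT]
  §1.4 consequence `CrystallinePointsOnUniqueComponent` ("'connects' is an equivalence relation")
  is NOT a clause: it follows from (F7) (accepted
  `CrystallineGenericFibreRegular.crystallinePointsOnUniqueComponent`);
  (F8) `PstWeilDeligneData`-clause `isEquivalent_weilRestrict_of_isLocallyUnramified` — the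
  FROBENIUS NORMALISATION of `WD ∘ D_pst` on UNRAMIFIED representations (clause addition of
  2026-08-16, statement re-type after the semantic-vacuity audit, sheet
  `docs/m5/faithfulness/Langlands.md` §4 row D(i)): for unramified `ρ : Γ_F →ₜ* GL_n(ℚ̄_ℓ)`,
  every Weil–Deligne representation the datum attaches to `ρ` is isomorphic to
  `(ρ|_{W_F}, N = 0)` (accepted `WeilDeligneRep.ofRep (ρ.weilRestrict F) _`,
  `WeilDeligneRep.IsEquivalent`). For the genuine datum this is Fontaine's computation
  (Exp. VIII §1.3, §2.3.7 with Exp. III §5): an unramified `ρ` is crystalline with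
  `D_cris(ρ) = (F̂₀^nr ⊗_{ℚ_ℓ} ρ)^{Γ_F}`, `φ = σ ⊗ 1`, and Fontaine's `W_F`-action
  `r(w) = φ^{-α(w)} w̄` (Deligne 1973 §8: geometric Frobenius ↔ `φ^{f}`) transports under the
  comparison isomorphism `F̂₀^nr ⊗_{F₀} D_cris(ρ) ≅ F̂₀^nr ⊗_{ℚ_ℓ} ρ` to `1 ⊗ ρ(w)`, so
  `WD(D_pst ρ) ≅ (ρ|_{W_F}, 0)` — the SAME normalisation as the `ℓ ≠ p` Grothendieck–Deligne
  recipe (accepted `IsWeilDeligneOfLadic`, which for unramified `ρW` forces `r.ρ = ρW`, `N = 0`)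
  used by the summit at `v ∤ ℓ`, and the only one under which the summit's `v ∣ ℓ` conjunct is
  consistent with its `𝓡`-free Satake–Frobenius clause for unramified Hecke characters. WHY:
  (F1)–(F7) constrain `IsWeilDeligneOf ρ r` for unramified `ρ` only through
  `wd_of_isLocallyUnramified` (`N = 0`, inertia trivial), so a datum whose relation is twisted
  by an unramified character `w ↦ c ^ deg w`, `c ≠ 1`, meets (F1)–(F7) whenever Fontaine's does,
  and the `v ∣ ℓ` conjunct of the summit's `LocalGlobalCompatibleAt` was undecidable for EVERY
  instance, even `n = 1`, `ρ = 1`; with (F8) it is decidable for representations unramified at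
  `v ∣ ℓ` (pending D2 for the ramified / positive-weight ones);
  (F9) `periodRing_eq_bdR` — the period ring of `𝔇` IS the accepted construction
  `bdRPeriodRingData hℓ` of Fontaine's `B_dR(F)` (clause addition of 2026-08-17 = D1 of the Upgrade
  path executed, see below: the period-ring half of the specification is categorical; the clause is a
  theorem-by-definition for the genuine datum, and is what `ε` is restricted to in `fontainePst`);
  (F10) `nonempty_pstCrystallineExtensionData` — COMPATIBLE CRYSTALLINE EXTENSION DATA EXIST OVER
  `𝔇` (clause addition of 2026-08-17, third use of the Upgrade path, cite item `wi-37787` of route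
  `Langlands/WachComponentCensus`, child `PinnedCrystallineExtensionDataExists`): the accepted
  interface `PstCrystallineExtensionData 𝔇` (file
  `GaloisRepresentations/PstCrystallineExtensionData`: crystalline period-ring data `K' ↦ 𝔅 K'`
  along the finite extensions of `F` inside `F̄`, with the compatibilities "`𝔇`-crystalline ⇒
  crystalline relative to `𝔅 K'` after restriction", "crystalline relative to `𝔅 ⊥` ⇒
  `𝔇`-crystalline", "restriction along `K' ≤ K''` preserves crystallinity", "for `F₀ = ⊤` the
  filtration of `𝔅 ⊥` computes the `𝔇.𝔅`-labelled Hodge–Tate weights") is INHABITED for `𝔇`.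
  For the genuine datum this is Fontaine's tower `K' ↦ B_cris(K')` (`B_cris` is
  `(ℚ_ℓ, G_K)`-regular with invariants `K₀` and carries `φ`, Exp. II §2.3, §4, Exp. III §5.1;
  `B_cris`-admissible = crystalline ⇔ de Rham with `N = 0` and inertia trivial on `D_pst` ⇔
  de Rham with `WD(ρ)` unramified, `N = 0`, Exp. VIII §1.3, §2.3.7 with Berger 2002 Thm. 0.7;
  crystalline points are `K'`-crystalline points, [BLGGT] §1.4 p. 13; `K ⊗_{K₀} D_cris ≅ D_dR`
  as filtered modules, Brinon–Conrad Prop. 9.1.9) — the same literature the accepted `∃`-fact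
  `PstCrystallineExtensionData.nonempty` records, which is `∃ 𝔇`-shaped and therefore says
  nothing about THE pinned datum; as a clause it is predicated of THE datum, so that the
  `∀ 𝔈 : PstCrystallineExtensionData (RD.pst p v hv)`-statements of the route (typed `PD2Unram`,
  PD lifting) are non-vacuous under `FontaineDatumExists`
  (`nonempty_pstCrystallineExtensionData_fontainePstAdicCompletion`,
  `FontaineDatumExists.pinnedCrystallineExtensionDataExists`);
  (F11) `cyclotomicPowersLabelledWeights` — THE POWERS OF THE CYCLOTOMIC CHARACTER HAVE LABELLED
  HODGE–TATE WEIGHTS `{-m}` (clause addition of 2026-08-17, fourth use of the Upgrade path, cite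
  item `wi-37786` of route `Langlands/WachComponentCensus`, child `PinnedCyclotomicPowersWeights`;
  the accepted predicate `PstWeilDeligneData.CyclotomicPowersLabelledWeights` of file
  `GaloisRepresentations/PstWeilDeligneCyclotomicPowersWeights`, written to be imported by this
  file, where it is called "candidate clause (F8)"): for every `m : ℤ`, every rank-one framed
  `χ : Γ_F →ₜ* GL₁(ℚ̄_ℓ)` with entries `ε_F(σ)^m` and every `ℚ_ℓ`-embedding `τ : F → ℚ̄_ℓ` (for the
  datum's `ℚ_ℓ`-structure), `HT_τ(χ) = {-m}` relative to `𝔇.𝔅`.  For the genuine datum this is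
  Fontaine's computation `D_dR(ℚ_ℓ(m)) = (B_dR ⊗ ε^m)^{Γ_F} = F · t^{-m} ⊗ e`, `Fil^i B_dR = t^i B_dR⁺`
  (Exp. II §1.5.5, Exp. III §1.5.4–1.5.5), i.e. `HT_τ(ε^m) = {-m}` in the convention of the accepted
  `PeriodRingData.labelledHodgeTateWeights` ([BLGGT] Introduction, Notation: "`HT_τ(ε_l) = {-1}`";
  Buzzard–Gee 2014 §2.4).  WHY: (F2) is the unlabelled interval condition on a finite model of `ε`
  itself and no other clause concerns `ε^m`, `m ∉ {0, 1}`, or labelled weights, while the pin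
  conjunct of every `∃ RD`-slice of `Langlands/WachComponentCensus` and `Langlands/TriangulineChamber`
  is precisely this statement for the pinned datum of each completion (reductions `pin_of_localPin`,
  `pin_of_localClause`); as a clause it is discharged from `FontaineDatumExists` in one line
  (`cyclotomicPowersLabelledWeights_fontainePstAdicCompletion`,
  `FontaineDatumExists.pinnedCyclotomicPowersWeights`).  Like (F2), the clause fails for the
  truncated model `F̂_nr` (accepted `not_cyclotomicPowersLabelledWeights_unramifiedPstWeilDeligneData`).
  (F12) `crystallineDetOnInertia` — THE DETERMINANT OF A CRYSTALLINE REPRESENTATION ON INERTIA,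
  DEGREE-ONE BASE (clause addition of 2026-08-17, fifth use of the Upgrade path, definition item
  `defn-CrystallineDetOnInertia` wanted by crux `stmt-Langlands-17008` =
  `NonParallelVoid.EmptyWeightCore`, whose stub S1 `stub_pinnedCrystallineDetLocal` of line
  `local_clause_cut` is verbatim its specialisation to the pinned datum of a completion `F_v = ℚ_ℓ`;
  the accepted predicate `PstWeilDeligneData.CrystallineDetOnInertia` of file
  `GaloisRepresentations/PstWeilDeligneCrystallineDetOnInertia`, written to be imported by this
  file): IF the datum's `ℚ_ℓ`-structure makes `ℚ_ℓ → F` surjective (`[F : ℚ_ℓ] = 1`), then every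
  `𝔇`-crystalline framed `ρ : Γ_F →ₜ* GL_n(ℚ̄_ℓ)` (`IsCrystallineFramed`) satisfies
  `det ρ(σ) = ε_F(σ)^{-Σ HT_τ(ρ)}` for every `σ ∈ I_F = absInertia F` and the (unique) label
  `τ : F →ₐ[ℚ_ℓ] ℚ̄_ℓ` (`HT_τ = 𝔇.𝔅.labelledHodgeTateWeights`, convention `HT_τ(ε) = {-1}` of (F11)).
  For the genuine datum this is the theorem that `det ρ = ∧ⁿρ` is a crystalline character with the
  single weight `Σ HT_τ(ρ)` (`D_cris` is an exact tensor functor on the ⊗-stable category of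
  crystalline representations, Brinon–Conrad §9.1 p. 133, Prop. 9.1.9, Prop. 9.1.11) and that the
  crystalline characters of `Γ_{ℚ_ℓ}` of Hodge–Tate weight `r` are exactly `ψ · ε^{-r}` with `ψ`
  unramified (Brinon–Conrad Prop. 8.3.4, p. 118–119, with coefficients Exercise 8.4.3 (1); Conrad
  2011, App. B Prop. B.4 (i): crystalline ⟺ algebraic on `𝒪^×`), together with Fontaine's
  characterisation "crystalline ⟺ de Rham, `WD` unramified, `N = 0`" (Exp. VIII §2.3.7) behind
  `IsCrystallineFramed`.  WHY: no clause among (F1)–(F11) concerns the inertial action of a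
  `𝔇`-crystalline representation of non-zero weights other than `ε^m` itself ((F4), (F11)), so S1 was
  undecidable for THE datum (skeleton vet of the crux, advisory A1); with (F12) it follows from
  `FontaineDatumExists` in one line (`crystallineDetOnInertia_fontainePstAdicCompletion`,
  `FontaineDatumExists.pinnedCrystallineDetOnInertia`) plus `[F_v : ℚ_ℓ] = 1` at a split prime.
  WHY DEGREE ONE: for `[F : ℚ_ℓ] > 1` the inertial determinant of a crystalline representation is a
  product over the labels of Lubin–Tate characters (Conrad 2011, Prop. B.3–B.4), whose normalisation
  the tree does not yet fix; the clause is vacuous there, hence harmless.  The truncated model `F̂_nr`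
  satisfies (F12) trivially (accepted `crystallineDetOnInertia_unramifiedPstWeilDeligneData`:
  crystalline = unramified, all weights `0`), and (F12) agrees with (F11) on the powers of `ε`
  (accepted `CyclotomicPowersLabelledWeights.det_eq_neg_sum_of_entry`).
  (F13) `fontaineLaffailleReductions` — REDUCTIONS OF FONTAINE–LAFFAILLE CRYSTALLINE
  REPRESENTATIONS, DEGREE-ONE BASE (clause addition of 2026-08-17, sixth use of the Upgrade path,
  requested by crux `stmt-Langlands-16779` = `RamifiedCoefficientSeed.AdjointLiftingGL3`, stub
  `stub_localFL` of line `birth`; the accepted predicate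
  `PstWeilDeligneData.FontaineLaffailleReductions` of file
  `GaloisRepresentations/PstWeilDeligneFontaineLaffaille`): IF `[F : ℚ_ℓ] = 1` for the datum's
  `ℚ_ℓ`-structure, then for every `𝔇`-crystalline framed `ρ` with labelled Hodge–Tate weights in
  `[w₀, w₀ + ℓ − 2]` and every reduction `ρ̄` of `ρ` (any lattice): (i) `ρ̄|_{I_F}` is
  triangularisable with diagonal the tame characters `ω_h^{−(d_j + q d_{j+1} + ⋯)}` of
  Fontaine–Laffaille blocks whose digits are the Hodge–Tate weights; (ii) a non-split rank-two
  subquotient with inertial diagonal `(ω^{−b}, ω^{−a})`, `a, b` weights, has `b < a` and is peu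
  ramifié (upper ramification groups `I^v`, `v > 1`, act trivially) when `a = b + 1`.  For the
  genuine datum this is Fontaine–Laffaille theory in the covariant normalisation (FL82 Prop. 4.4,
  Thm. 5.3 (iii), Thm. 6.1, Thm. 8.4; CHT 2008 §2.4.1 and Lemma 2.4.2; BLGGT 2014 §1.4: any lattice in
  a crystalline representation with weights in `[0, ℓ−2]` is `G_K(M)`, `HT = FL`, essential image
  closed under subquotients; GHLS 2017 Prop. 2.3.1: FL ⇒ peu ramifié; Conrad 1997 Thm. 1.8 for
  weights `{0,1}`).  WHY: no clause among (F1)–(F12) constrains the reduction of a `𝔇`-crystalline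
  representation of rank `≥ 2`, so the Serre weight of a residual constituent of a crystalline `ρ`
  was undecidable for THE datum; with (F13) it follows from `FontaineDatumExists`
  (`fontaineLaffailleReductions_fontainePstAdicCompletion`,
  `FontaineDatumExists.pinnedFontaineLaffailleReductions`).  WHY DEGREE ONE: as (F12).
  (F14) `isCrystallineFramed_of_ordinary_regular` — ORDINARY OF REGULAR WEIGHT WITH CRYSTALLINE
  DIAGONAL CHARACTERS ⇒ CRYSTALLINE (clause addition of 2026-08-17, seventh use of the Upgrade path,
  made by the discharge unit `provefact-Literature.NumberTheory.PAdicHodge.GeeGe-041f5ed953` of the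
  named fact `GeeGeraghty2012.crystalline_of_ordinary_regular` of file
  `PAdicHodge/CrystallineOfOrdinaryRegular`, which is VERBATIM this clause predicated of the pinned
  datum `fontainePst F ℓ hℓ` and was requested by line `thorne-minimal-lift` of crux
  `stmt-Langlands-13757`): for every rank `n`, every CANONICAL local Artin datum `art`
  (accepted `LocalArtinData.IsCanonical`: `art.artin` is THE Artin map `canonicalArtin F`, Deligne's
  normalisation geometric Frobenius ↦ uniformiser), every `ρ : Γ_F →ₜ* GL_n(ℚ̄_ℓ)` and every labelled
  weight `λ : LabelledWeight F ℚ̄_ℓ n` (accepted, `OrdinaryRegular`): IF `λ` is dominant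
  (`λ_{τ,1} ≥ ⋯ ≥ λ_{τ,n}`) and regular (for each `j < n` some label `τ` with `λ_{τ,j} > λ_{τ,j+1}`),
  and after a change of frame `ρ` is upper triangular with `i`-th diagonal entry (`i : Fin n`,
  accepted `FramedRep.diagEntry`) EQUAL to `∏_τ τ(Art_F⁻¹ w)^{-(λ_{τ,n-i} + i)}` (accepted
  `ordinaryWeightUnit λ i (art.artin w)`) at EVERY `w` in the inertia subgroup of the Weil group,
  THEN `ρ` is `𝔇`-crystalline (`IsCrystallineFramed`).  For the genuine datum this is Gee–Geraghty
  2012, Lemma 3.1.4 (3) with `E = ℚ̄_ℓ` (arXiv:1001.2044 §3.1.2 pp. 6–7: Def. 3.1.2,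
  `χ^λ_j(σ) = ε(σ)^{-(j-1)} ∏_τ τ(Art_M⁻¹ σ)^{-λ_{τ,n-j+1}}` on `I_M`, `Art_M` "normalized to take
  uniformizers to lifts of geometric Frobenius"; "`ρ` is ordinary of weight `λ`" = conjugate to upper
  triangular with `ψ_j = χ^λ_j` on an open subgroup of `I_M`; Lemma 3.1.4: "(2) If each `ψ_j` is
  crystalline (which occurs if and only if `ψ_j` agrees with `χ^λ_j` on all of `I_M`), then `ρ` is
  semistable. (3) If each `ψ_j` is crystalline and `λ` is regular, then `ρ` is crystalline", proved
  there from Nekovář 1993, Props. 1.24, 1.26, 1.28; cf. Perrin-Riou 1994: ordinary representations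
  are semistable), the diagonal character being `χ^λ_{i+1} ∘ Art_F = ∏_τ τ^{-(λ_{τ,n-i} + i)}` by
  the class-field-theoretic identity `ε ∘ Art_F = N_{F/ℚ_ℓ} = ∏_τ τ` on `𝒪_Fˣ` for the geometric
  normalisation (the rendering of
  `χ^λ_j` fixed by the accepted `ordinaryWeightUnit` / `IsOrdinaryOfLabelledWeight`, module docstring
  of `OrdinaryRegular`; BLGGT §1.4: `(χ ∘ Art_K)|_U = ∏_τ τ^{b_τ}` has `HT_τ = -b_τ`, `HT_τ(ε) = -1`),
  and "crystalline" being Fontaine's "de Rham with `WD ∘ D_pst` unramified and `N = 0`" (Exp. VIII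
  §2.3.7) behind `IsCrystallineFramed`.  WHY: clauses (F1)–(F13) produce `𝔇`-crystallinity only for
  unramified representations (structure axioms) and the cyclotomic character ((F4)), while an ordinary
  representation of regular weight in rank `≥ 2` is infinitely ramified; the accepted twin theorem
  `Summit.…EmptyWeightCore.Negative.exists_twin_fontainePst_isCrystallineFramed_imp_isLocallyUnramified`
  (a datum on `B_dR` with the structure axioms and NO ramified crystalline representation of rank
  `≥ 2`) shows that no argument uniform over Hilbert's `ε` certifies the named fact, so it was
  undischargeable short of D2; as a clause it follows from `FontaineDatumExists` in one line
  (`fontainePst_isCrystallineFramed_of_ordinary_regular`,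
  `FontaineDatumExists.isCrystallineFramed_of_ordinary_regular`, whose statement is the named fact's
  body).  The clause couples the pin to the Artin pin `canonicalArtin F` (as the summit's
  `llc_isCanonical` already does); it is stated for every `F` (no degree-one restriction: the labels
  `τ` carry the Lubin–Tate normalisation that (F12) avoids).
* `FontaineDatumExists` — the NAMED FACT (D-0014; cone tier T0 for `Langlands`) that for every
  characteristic-`0` non-archimedean local field `F` of residue characteristic `ℓ` some datum
  satisfies the clauses: this is Fontaine's construction (`B_dR`, `B_st`, `D_pst`, `WD`) with the
  theorems (F2)–(F4), (F8), (F11) and (F12), the five structure axioms (Berger 2002 Thm. 0.7 for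
  `exists_of_isDeRham`), Kisin's theorems (F5)–(F7) for it (Kisin 2008, Cor. (2.7.7), (3.3.3),
  Thm. (3.3.8)) and Fontaine's `B_cris`-tower for (F10). Discharging it (`theorem FontaineDatumExists_holds`) is the build debt
  filed with this ruling; the honest discharge IS the construction (definition item
  `defn-FontainePstWeilDeligneData`, components (ii) `B_dR(K_v)` as a `PeriodRingData` and (iii)
  `WD ∘ D_pst`; component (i) is the accepted `PadicAlgebraOfLocalField`) followed by the
  verification of the clauses for it, of which (F5)–(F7) is the formalisation of Kisin 2008 for
  the constructed `B_cris ⊆ B_dR` (formerly the separate debt `Kisin2007_crystallineDeformationRings`,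
  now a corollary: debt is re-keyed, not created), and (F14) the formalisation of Gee–Geraghty 2012
  Lemma 3.1.4 (3) (Nekovář 1993 §1) for the constructed `D_st` (formerly the separate debt
  `GeeGeraghty2012.crystalline_of_ordinary_regular`, now a corollary in the same sense).
* `fontainePst F ℓ hℓ : PstWeilDeligneData F ℓ` — **THE datum**.  D1 UPGRADE (2026-08-17): the
  period ring is now the CONSTRUCTION — Hilbert's `ε` ranges over the subtype of data whose
  `ℚ_ℓ`-structure is the canonical one and whose period ring IS `bdRPeriodRingData hℓ` (Fontaine's
  `B_dR(F) = Frac B_dR⁺(F)` with `B_dR^{Γ_F} = F` by Ax–Sen–Tate, file `BdRPeriodRingData`; the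
  subtype is inhabited, accepted `nonempty_pstWeilDeligneData_bdR`, which only serves `Nonempty`),
  with the clauses `IsFontaineDatum hℓ` as the selecting predicate.  UNCONDITIONALLY, therefore,
  `(fontainePst F ℓ hℓ).𝔅 = bdRPeriodRingData hℓ` (`fontainePst_𝔅_eq_bdRPeriodRingData`) and the
  algebra structure is canonical (`fontainePst_algebra_eq_padicAlgebra`): "de Rham for THE datum"
  IS Fontaine's `B_dR`-admissibility of a finite model, a decidable notion (unramified, cyclotomic
  and finite-image representations are de Rham for it: files `BdRUnramified`, `BdRCyclotomic`,
  `BdRFiniteImage`, `fontainePst_isDeRhamFramed_of_finite_range`).  By `Classical.epsilon_spec`,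
  under `FontaineDatumExists` the datum satisfies every clause (`isFontaineDatum_fontainePst`; a
  datum with the clauses has (F1) and (F9), so it lies in the subtype).  What REMAINS pinned by
  specification is the Weil–Deligne half `IsWeilDeligneOf`: a statement about it is provable
  exactly when it holds for EVERY datum on `B_dR` with the clauses (STRONGER than the intended
  statement, never weaker; decidable on unramified representations by (F8), pending D2 otherwise).
  The clauses at `v ∤ ℓ` and the Satake–Frobenius clause are unaffected.
* `fontainePstAdicCompletion v ℓ hv` — the specialisation to `F = K_v = v.adicCompletion K`, `K` a
  number field, `v ∣ ℓ` (`(ℓ : 𝓞 K) ∈ v.asIdeal`; accepted `LocalField.charZero_adicCompletion`,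
  `LocalField.valuation_adicCompletion_natCast_lt_one`, instance
  `instIsNonarchimedeanLocalFieldAdicCompletion`). This is the term the summit statement
  `Summits/Langlands/Langlands/Statement.lean` uses for `ReciprocityData.pst`.

## Upgrade path (definition items D1/D2 of HUMAN-QUESTIONS L2; no re-ruling needed)

When `B_dR(F)` (D1) and `D_pst`, `WD ∘ D_pst` (D2) are constructed in the tree, the BODY of
`fontainePst` is replaced by the construction (same name, same type), `IsFontaineDatum` gains the
clause "`𝔇` is that construction" (making the specification categorical), and
`FontaineDatumExists_holds` is its verification. Until then literature seats may ADD clauses to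
`IsFontaineDatum` that are theorems for the genuine datum (each addition can only weaken the
summit toward its intended meaning); a clause that FAILS for the genuine datum would empty the
specification, so clauses are reviewed as summit-grade text (registry premise, D-0018). First
such addition: (F5)–(F7), Kisin's theorems (2026-08-16, see above); second: (F8), the Frobenius
normalisation of `WD ∘ D_pst` on unramified representations (2026-08-16, see above); third: (F10),
existence of compatible crystalline extension data (`B_cris`-tower) over the datum (2026-08-17, see
above); fourth: (F11), the labelled Hodge–Tate weights `{-m}` of the powers `ε^m` of the cyclotomic
character (2026-08-17, see above); fifth: (F12), the determinant of a crystalline representation on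
inertia over a degree-one base, `det ρ|_{I_F} = ε^{-Σ HT_τ(ρ)}` (2026-08-17, see above); sixth:
(F13), Fontaine–Laffaille reductions over a degree-one base (2026-08-17, see above); seventh: (F14),
Gee–Geraghty 2012 Lemma 3.1.4 (3) — ordinary of dominant regular labelled weight with diagonal
characters `χ^λ_j` on all of inertia ⇒ crystalline (2026-08-17, see above).
D1 EXECUTED (2026-08-17): `B_dR(F)` is constructed in the tree as the period-ring datum
`bdRPeriodRingData` (files `FontaineTheta*`, `BdRPlus*`, `BdRField`, `BdRPeriodRingData`: Ax–Sen–Tate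
for `B_dR^{Γ_F} = F`, Fontaine's regularity), so the period-ring half of the body of `fontainePst`
IS now the construction (`ε` restricted to the data ON `B_dR`, see `fontainePst`) and
`IsFontaineDatum` gained the categorical clause (F9) `periodRing_eq_bdR` ("the period ring of `𝔇`
is that construction"; a theorem-by-definition for the genuine datum).  The Weil–Deligne half (D2:
`B_st`, `D_pst`, Fontaine's recipe) remains specified by (F4), (F8) and the structure axioms.

## What is deliberately NOT here

* No construction of `B_cris`, `B_st`, `D_pst` (see above; `B_dR(F)` IS constructed, file
  `BdRPeriodRingData`, and is the period ring of `fontainePst` since 2026-08-17; clause (F10) only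
  asserts that SOME compatible crystalline extension data exist over the datum) and no typed
  Fontaine recipe `(φ, N, Gal(F'/F))-module ↦ WD` (definable, ~400 lines, but not connectable to `ρ`
  without `D_pst`; a separate definition item if a route wants it typed).
* No Frobenius-eigenvalue normalisation clause for `WD` BEYOND the unramified case (F8): for
  ramified-at-`ℓ` or positive-weight `ρ` (e.g. `ℚ_ℓ(1)`: `φ = ℓ⁻¹ σ` on `D_cris`) the eigenvalue
  convention is fixed only by the construction, and a wrong sign there would empty the
  specification; (F8) is safe because on unramified `ρ` the normalisation is forced by agreement
  with the `ℓ ≠ p` recipe `IsWeilDeligneOfLadic` (see (F8) above).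
* No new axiom, no `sorry`; axioms of every declaration ⊆ {propext, Classical.choice, Quot.sound}.

## References

* J.-M. Fontaine, *Le corps des périodes p-adiques* (Exp. II), *Représentations p-adiques
  semi-stables* (Exp. III), *Représentations ℓ-adiques potentiellement semi-stables* (Exp. VIII),
  Astérisque 223 (1994). [FontaineAsterisque223III] [FontaineAsterisque223VIII]
* L. Berger, *Représentations p-adiques et équations différentielles*, Invent. Math. 148 (2002),
  Thm. 0.7 (de Rham ⇒ potentially semistable). [BergerLaurent2002]
* M. Kisin, *Potentially semi-stable deformation rings*, J. Amer. Math. Soc. 21 (2008), 513–546: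
  Introduction, Thm. (2.5.5), Cor. (2.7.7) (p. 528), (3.3.3) (p. 533), Thm. (3.3.8) (p. 535).
  [Kisin2007]
* T. Barnet-Lamb, T. Gee, D. Geraghty, R. Taylor, *Potential automorphy and change of weight*,
  Ann. of Math. 179 (2014), §1.2–1.4 (pp. 12–14 of arXiv:1010.2561; p. 13: `* = cris`,
  `K'-cris`). [BarnetlambEtAl2014]
* O. Brinon, B. Conrad, *CMI Summer School notes on `p`-adic Hodge theory* (2009), Thm. 9.1.5,
  Prop. 9.1.9 (`K ⊗_{K₀} D_cris ≅ D_dR`), §9.3 (Prop. 9.3.1); for (F12): Prop. 8.3.4 (p. 118–119),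
  Exercise 8.4.3 (1) (p. 127), §9.1 p. 133, Prop. 9.1.11. [BrinonConrad2009]
* B. Conrad, *Lifting global representations with local properties* (2011), Appendix B,
  Prop. B.3, Prop. B.4. [Conrad2011LiftingGlobal]
* J.-M. Fontaine, B. Mazur, *Geometric Galois representations* (1995), §1. [FontaineMazurGeometric1995]
* R. Taylor, *Galois representations*, Ann. Fac. Sci. Toulouse (6) 13 (2004), §1 pp. 79–80.
  [TaylorGaloisRepresentations2004]
* K. Buzzard, T. Gee, *The conjectural connections …* (2014), §2.2. [BuzzardGee2014]
* J. Tate, *Number theoretic background*, Corvallis 1979, (4.1.3), (4.2.1). [TateCorvallis1979]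
* P. Deligne, *Les constantes des équations fonctionnelles des fonctions `L`*, Antwerp II,
  LNM 349 (1973), §8 (Weil–Deligne representations; the `ℓ ≠ p` dictionary). [DeligneAntwerpII1973]
* J.-P. Serre, *Local Fields* (1979), Ch. II §5. [SerreLocalFields1979]
* T. Gee, D. Geraghty, *Companion forms for unitary and symplectic groups*, Duke Math. J. 161
  (2012), 247–303, §3.1.2 (regular weights, `Art_M`), Def. 3.1.2 (`χ^λ_j`), Lemma 3.1.4 (3)
  (arXiv:1001.2044, pp. 6–7); for (F14). [GeeGeraghty2012]
* J. Nekovář, *On `p`-adic height pairings*, Sém. Théorie des Nombres Paris 1990–91, Progr. Math.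
  108 (1993), 127–202, Props. 1.24, 1.26, 1.28 (the proof Gee–Geraghty cite for Lemma 3.1.4).
  [Nekovar1993]
* B. Perrin-Riou, *Représentations `p`-adiques ordinaires*, Astérisque 223 (1994), 185–220
  (ordinary ⇒ semistable; context for (F14)). [PerrinRiou1994Ordinaires]
-/

noncomputable section

open Field IsDedekindDomain ValuativeRel
open scoped NumberField MatrixGroups
open Literature.NumberTheory.GaloisRepresentations

namespace Literature.NumberTheory.PAdicHodge

/-! ### The characterising clauses and the pinned datum over a local field -/

section Local

variable {F : Type} [Field F] [ValuativeRel F] [TopologicalSpace F] [IsNonarchimedeanLocalField F]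
  [CharZero F] {ℓ : ℕ} [Fact ℓ.Prime]

/-- **Fontaine's characterising clauses** for a `p`-adic Hodge datum `𝔇 : PstWeilDeligneData F ℓ`
over the characteristic-`0` local field `F` of residue characteristic `ℓ` (`hℓ : |ℓ|_F < 1`) —
the properties of the genuine `(B_dR(F), WD ∘ D_pst)` that the accepted tree can phrase:
(F1) `algebra_eq`: the `ℚ_ℓ`-structure on `F` is the canonical `LocalField.padicAlgebra F ℓ hℓ`
(Serre, *Local Fields* II §5); (F2) `cyclotomicWeightNegOne`: the cyclotomic character is de Rham
of Hodge–Tate weight `-1` (Fontaine 1994, Exp. III §1.5; the non-truncation clause);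
(F3) `unramifiedWeightsZero`: unramified representations are de Rham with all weights `0`
(Exp. III §5); (F4) `isCrystallineFramed_cyclotomic`: the cyclotomic character is crystalline —
de Rham with unramified Weil–Deligne representation and `N = 0` (Exp. VIII §1.3, §2.3.7);
(F5) `hasCrystallineDeformationRings`, (F6) `hasHodgeTypeCrystallineDeformationRings`,
(F7) `crystallineGenericFibreRegular`: Kisin's theorems — the reduced `ℓ`-torsion-free quotients
of the universal framed deformation ring `R^□_{𝒪_L,ρ̄}` cut out by the crystalline lifts with
Hodge–Tate weights in an interval, resp. of a fixed labelled Hodge type, exist (Kisin 2008,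
Introduction, Thm. (2.5.5), Cor. (2.7.7), (3.3.3); [BLGGT] §1.4), and the latter have regular
generic fibres, equidimensional of dimension `n² + Σ_τ dim GL_n/P_{v_τ}` (Thm. (3.3.8):
"`Spec (R^□_{V_𝔽}[1/p])^{τ,v}_{cr}` is formally smooth and equi-dimensional of dimension
`d² + dim_E adD_{E,K}/Fil⁰ adD_{E,K}`") — the accepted predicates of
`CrystallineDeformationRing(Smooth)`, added 2026-08-16 (see the module docstring for why);
(F8) `isEquivalent_weilRestrict_of_isLocallyUnramified`: for UNRAMIFIED `ρ` every attached
Weil–Deligne representation is isomorphic to `(ρ|_{W_F}, N = 0)` (accepted `WeilDeligneRep.ofRep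
(ρ.weilRestrict F) _`) — the Frobenius normalisation of `WD ∘ D_pst` on unramified
representations (Fontaine 1994, Exp. VIII §1.3, §2.3.7: unramified ⇒ crystalline,
`D_cris(ρ) = (F̂₀^nr ⊗ ρ)^{Γ_F}`, `r(w) = φ^{-α(w)} w̄`; Deligne 1973 §8; the same normalisation as
the `ℓ ≠ p` recipe `IsWeilDeligneOfLadic`), added 2026-08-16 (see the module docstring for why).
(F9) `periodRing_eq_bdR`: the period ring `𝔇.𝔅` IS the accepted construction `bdRPeriodRingData hℓ`
of Fontaine's `B_dR(F)` (`B_dR^{Γ_F} = F` by Ax–Sen–Tate; Fontaine 1994, Exp. II §1.5, Exp. III §3) —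
the categorical clause of the Upgrade path for the period-ring half, added 2026-08-17.
(F10) `nonempty_pstCrystallineExtensionData`: compatible crystalline extension data over `𝔇` exist —
the accepted interface `PstCrystallineExtensionData 𝔇` is inhabited (intended `K' ↦ B_cris(K')`:
Fontaine 1994, Exp. III §5.1, Exp. VIII §1.3, §2.3.7; Berger 2002 Thm. 0.7; Brinon–Conrad
Prop. 9.1.9; [BLGGT] §1.4 p. 13), added 2026-08-17 (see the module docstring for why).
(F11) `cyclotomicPowersLabelledWeights`: the powers `ε^m` (`m : ℤ`) of the cyclotomic character have
`τ`-labelled Hodge–Tate weights `{-m}` relative to `𝔇.𝔅` at every `ℚ_ℓ`-embedding `τ : F → ℚ̄_ℓ`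
(accepted `PstWeilDeligneData.CyclotomicPowersLabelledWeights`; Fontaine 1994, Exp. III §1.5:
`D_dR(ℚ_ℓ(m)) = F · t^{-m}`; [BLGGT] Notation `HT_τ(ε) = {-1}`; Buzzard–Gee 2014 §2.4), added
2026-08-17 (see the module docstring for why).
(F12) `crystallineDetOnInertia`: over a DEGREE-ONE base (the datum's `ℚ_ℓ`-structure makes
`ℚ_ℓ → F` surjective) every `𝔇`-crystalline framed `ρ : Γ_F →ₜ* GL_n(ℚ̄_ℓ)` has
`det ρ(σ) = ε_F(σ)^{-Σ HT_τ(ρ)}` for `σ ∈ I_F` and the unique label `τ` (accepted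
`PstWeilDeligneData.CrystallineDetOnInertia`; Brinon–Conrad §9.1 p. 133 and Prop. 9.1.11: `det` of
crystalline is crystalline of the sum weight; Prop. 8.3.4, Exercise 8.4.3 (1): crystalline characters
of `Γ_{ℚ_ℓ}` are `ψ · ε^{-r}`, `ψ` unramified; Conrad 2011, Prop. B.4; Fontaine 1994, Exp. VIII
§2.3.7), added 2026-08-17 (see the module docstring for why).
(F13) `fontaineLaffailleReductions`: over a DEGREE-ONE base, the reductions (any lattice) of a
`𝔇`-crystalline framed `ρ` with labelled Hodge–Tate weights in an interval of length `≤ ℓ − 2` have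
Fontaine–Laffaille tame inertia weights equal to the Hodge–Tate weights, and their non-split rank-two
subquotients are correctly ordered and, for consecutive weights, peu ramifiés (accepted
`PstWeilDeligneData.FontaineLaffailleReductions`; Fontaine–Laffaille 1982 Prop. 4.4, Thm. 5.3 (iii);
Clozel–Harris–Taylor 2008 §2.4.1, Lemma 2.4.2; Barnet-Lamb–Gee–Geraghty–Taylor 2014 §1.4;
Gee–Herzig–Liu–Savitt 2017 Prop. 2.3.1; Conrad 1997 Thm. 1.8), added 2026-08-17 (sixth use of the
Upgrade path, requested by crux `stmt-Langlands-16779`, line `birth`, stub `stub_localFL`).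
(F14) `isCrystallineFramed_of_ordinary_regular`: for every rank `n`, every CANONICAL local Artin
datum `art` (`LocalArtinData.IsCanonical`, geometric Frobenius ↦ uniformiser), every
`ρ : Γ_F →ₜ* GL_n(ℚ̄_ℓ)` and every labelled weight `λ`: if `λ` is dominant and regular and, after a
change of frame, `ρ` is upper triangular with `i`-th diagonal entry `∏_τ τ(Art_F⁻¹ w)^{-(λ_{τ,n-i}+i)}`
(`ordinaryWeightUnit λ i (art.artin w)`, i.e. `χ^λ_{i+1}`) at every `w` in the inertia subgroup of
the Weil group, then `ρ` is `𝔇`-crystalline (Gee–Geraghty 2012, §3.1.2, Def. 3.1.2 and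
Lemma 3.1.4 (3): "If each `ψ_j` is crystalline [⟺ `ψ_j = χ^λ_j` on all of `I_M`] and `λ` is
regular, then `ρ` is crystalline", from Nekovář 1993, Props. 1.24, 1.26, 1.28), added 2026-08-17
(seventh use of the Upgrade path, by the discharge unit of the named fact
`GeeGeraghty2012.crystalline_of_ordinary_regular`, which is this clause for `fontainePst F ℓ hℓ`;
see the module docstring for why).
A `Prop`-valued structure; every field is a theorem of the literature for Fontaine's datum.
[cite: GeeGeraghty2012, §3.1.2, Def. 3.1.2 and Lemma 3.1.4 (3)]
[cite: FontaineLaffaille1982, Prop. 4.4 and Thm. 5.3 (iii)]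
[cite: ClozelHarrisTaylor2008, §2.4.1 and Lemma 2.4.2]
[cite: GeeHerzigLiuSavitt2017, Prop. 2.3.1]
[cite: Conrad1997Flat, Thm. 1.8]
[cite: FontaineAsterisque223III, Exp. III §1.5, §3 and §5]
[cite: FontaineAsterisque223VIII, §1.3 and §2.3.7] [cite: DeligneAntwerpII1973, §8.4]
[cite: Kisin2007, Cor. 2.7.7, (3.3.3) and Thm. 3.3.8] [cite: BarnetlambEtAl2014, §1.4]
[cite: BergerLaurent2002, Thm. 0.7] [cite: BrinonConrad2009, Prop. 9.1.9]
[cite: BuzzardGeeLMS2014, §2.4 (labelled Hodge–Tate weights; `HT_τ(ε) = {-1}`)]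
[cite: BrinonConrad2009, Prop. 8.3.4, Exercise 8.4.3 (1) and Prop. 9.1.11]
[cite: Conrad2011LiftingGlobal, Appendix B, Prop. B.4] -/
structure IsFontaineDatum (hℓ : valuation F ℓ < 1) (𝔇 : PstWeilDeligneData F ℓ) : Prop where
  /-- (F1) The `ℚ_ℓ`-algebra structure carried by the datum is the canonical one. -/
  algebra_eq : 𝔇.algebra = LocalField.padicAlgebra F ℓ hℓ
  /-- (F2) The cyclotomic character is `𝔇`-de Rham with all Hodge–Tate weights equal to `-1`. -/
  cyclotomicWeightNegOne : 𝔇.CyclotomicWeightNegOne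
  /-- (F3) Unramified representations are `𝔇`-de Rham with all Hodge–Tate weights `0`. -/
  unramifiedWeightsZero : 𝔇.UnramifiedWeightsZero
  /-- (F4) The cyclotomic character is `𝔇`-crystalline: de Rham, `WD` unramified, `N = 0`. -/
  isCrystallineFramed_cyclotomic :
    𝔇.IsCrystallineFramed (FramedGaloisRep.cyclotomicPadicAlgCl F ℓ)
  /-- (F5) Kisin: the `𝔇`-crystalline deformation rings with Hodge–Tate weights in an interval
  `[a, b]` exist (Kisin 2008, Introduction, Thm. (2.5.5), Cor. (2.7.7), (3.3.3)). -/
  hasCrystallineDeformationRings : 𝔇.HasCrystallineDeformationRings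
  /-- (F6) Kisin / [BLGGT] §1.4: the `𝔇`-crystalline deformation rings of every labelled Hodge
  type `{v_τ}` exist over `𝒪_L`, `L ⊇ τ(F)` ((3.3.3) with Cor. (2.7.7)). -/
  hasHodgeTypeCrystallineDeformationRings : 𝔇.HasHodgeTypeCrystallineDeformationRings
  /-- (F7) Kisin, Thm. (3.3.8): their generic fibres `R[1/ℓ]` are regular rings, equidimensional
  of dimension `n² + Σ_τ hodgeTypeFlagDim (v τ)`. -/
  crystallineGenericFibreRegular : 𝔇.CrystallineGenericFibreRegular
  /-- (F8) Frobenius normalisation on unramified representations: for unramified `ρ`, every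
  Weil–Deligne representation `𝔇` attaches to `ρ` is isomorphic to `(ρ|_{W_F}, N = 0)`
  (Fontaine 1994, Exp. VIII §1.3, §2.3.7; Deligne 1973 §8: `WD(D_pst ρ) ≅ (ρ|_{W_F}, 0)`). -/
  isEquivalent_weilRestrict_of_isLocallyUnramified :
    ∀ {n : ℕ} (ρ : FramedRep (absoluteGaloisGroup F) (PadicAlgCl ℓ) n)
      (r : WeilDeligneRep F (PadicAlgCl ℓ) (Fin n → PadicAlgCl ℓ)) (hρ : ρ.IsLocallyUnramified),
      𝔇.IsWeilDeligneOf ρ r →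
        r.IsEquivalent
          (WeilDeligneRep.ofRep (ρ.weilRestrict F) hρ.isUnramifiedRep_weilRestrict.isContinuousRep)
  /-- (F9) The period ring carried by the datum IS Fontaine's `B_dR(F)` — the accepted CONSTRUCTION
  `bdRPeriodRingData hℓ` (`B_dR(F) = Frac B_dR⁺(F)` with its `Γ_F`-action, `F`-structure and
  `ξ`-adic filtration, `B_dR^{Γ_F} = F` by Ax–Sen–Tate; file `BdRPeriodRingData`), for the datum's
  own `ℚ_ℓ`-structure: the period-ring half of the specification is CATEGORICAL (D1 of the Upgrade
  path; Fontaine 1994, Exp. II §1.5, Exp. III §1.5, §3). -/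
  periodRing_eq_bdR :
    haveI : Fact (¬ IsUnit ((ℓ : ℕ) : integerC F)) := ⟨not_isUnit_natCast_integerC hℓ⟩
    haveI : IsAdicComplete (Ideal.span {((ℓ : ℕ) : integerC F)}) (integerC F) :=
      isAdicComplete_integerC_natCast hℓ
    𝔇.𝔅 = (letI := 𝔇.algebra; bdRPeriodRingData (F := F) (p := ℓ) hℓ)
  /-- (F10) Compatible crystalline extension data over `𝔇` EXIST: the accepted interface
  `PstCrystallineExtensionData 𝔇` — crystalline period-ring data `K' ↦ 𝔅 K'` along the finite
  extensions of `F` inside `F̄` with "`𝔇`-crystalline ⇒ crystalline relative to `𝔅 K'` after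
  restriction", "crystalline relative to `𝔅 ⊥` ⇒ `𝔇`-crystalline", "restriction along `K' ≤ K''`
  preserves crystallinity" and "for `F₀ = ⊤` the filtration of `𝔅 ⊥` computes the `𝔇.𝔅`-labelled
  Hodge–Tate weights" — is inhabited.  For Fontaine's datum: the tower `K' ↦ B_cris(K')`
  (Fontaine 1994, Exp. II §2.3, §4 and Exp. III §5.1: `B_cris` is `(ℚ_ℓ, G_K)`-regular with
  invariants `K₀`, carries `φ`, `B_cris`-admissible = crystalline; Exp. VIII §1.3, §2.3.7 with
  Berger 2002 Thm. 0.7: crystalline ⇔ de Rham with `WD(ρ)` unramified and `N = 0`; [BLGGT] §1.4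
  p. 13: crystalline points are `K'`-crystalline points; Brinon–Conrad Prop. 9.1.9:
  `K ⊗_{K₀} D_cris ≅ D_dR` as filtered modules). -/
  nonempty_pstCrystallineExtensionData : Nonempty (PstCrystallineExtensionData 𝔇)
  /-- (F11) The powers of the cyclotomic character have labelled Hodge–Tate weights `{-m}`: for
  every `m : ℤ`, every rank-one framed `χ : Γ_F →ₜ* GL₁(ℚ̄_ℓ)` with entries `ε_F(σ)^m` and every
  `ℚ_ℓ`-embedding `τ : F → ℚ̄_ℓ` for `𝔇.algebra`, `𝔇.𝔅.labelledHodgeTateWeights χ τ = {-m}`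
  (Fontaine 1994, Exp. II §1.5.5 and Exp. III §1.5.4–1.5.5: `D_dR(ℚ_ℓ(m)) = F · t^{-m} ⊗ e`,
  `Fil^i B_dR = t^i B_dR⁺`; [BLGGT] Introduction, Notation: `HT_τ(ε_l) = {-1}`; Buzzard–Gee 2014
  §2.4). -/
  cyclotomicPowersLabelledWeights : 𝔇.CyclotomicPowersLabelledWeights
  /-- (F12) The determinant of a crystalline representation on inertia, degree-one base: if the
  datum's `ℚ_ℓ`-structure makes `ℚ_ℓ → F` surjective (`[F : ℚ_ℓ] = 1`), then every `𝔇`-crystalline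
  framed `ρ : Γ_F →ₜ* GL_n(ℚ̄_ℓ)` satisfies `det ρ(σ) = ε_F(σ)^{-Σ HT_τ(ρ)}` for every
  `σ ∈ I_F = absInertia F` and the unique `ℚ_ℓ`-embedding `τ : F → ℚ̄_ℓ`
  (`HT_τ = 𝔇.𝔅.labelledHodgeTateWeights`; Brinon–Conrad §9.1 p. 133, Prop. 9.1.11: `det ρ` is a
  crystalline character of the sum weight; Prop. 8.3.4, Exercise 8.4.3 (1) and Conrad 2011
  Prop. B.4: crystalline characters of `Γ_{ℚ_ℓ}` of weight `r` are `ψ · ε^{-r}`, `ψ` unramified;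
  Fontaine 1994, Exp. VIII §2.3.7 for the `D_pst` phrasing of "crystalline"). -/
  crystallineDetOnInertia : 𝔇.CrystallineDetOnInertia
  /-- (F13) Reductions of Fontaine–Laffaille crystalline representations, degree-one base: if the
  datum's `ℚ_ℓ`-structure makes `ℚ_ℓ → F` surjective (`[F : ℚ_ℓ] = 1`), then for every
  `𝔇`-crystalline framed `ρ : Γ_F →ₜ* GL_n(ℚ̄_ℓ)` whose labelled Hodge–Tate weights lie in an
  interval `[w₀, w₀ + ℓ − 2]` and every reduction `ρ̄` of `ρ` (any lattice): (i) `ρ̄|_{I_F}` is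
  triangularisable with diagonal the tame characters of Fontaine–Laffaille blocks whose digits are
  the Hodge–Tate weights (Fontaine–Laffaille 1982, Prop. 4.4, Thm. 5.3 (iii); Barnet-Lamb–Gee–
  Geraghty–Taylor 2014 §1.4 / Clozel–Harris–Taylor 2008 §2.4.1: any lattice is `G_K(M)`,
  `HT = FL`), (ii) a non-split rank-two subquotient with inertial diagonal `(ω^{-b}, ω^{-a})`,
  `a, b` weights, has `b < a`, and is peu ramifié when `a = b + 1` (CHT Lemma 2.4.2;
  Gee–Herzig–Liu–Savitt 2017 Prop. 2.3.1; Conrad 1997 Thm. 1.8) — the accepted predicate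
  `PstWeilDeligneData.FontaineLaffailleReductions`. -/
  fontaineLaffailleReductions : 𝔇.FontaineLaffailleReductions
  /-- (F14) Gee–Geraghty 2012, Lemma 3.1.4 (3): ordinary of dominant REGULAR labelled weight with
  diagonal characters `χ^λ_j` on ALL of inertia (each `ψ_j` crystalline) ⇒ `𝔇`-crystalline.  For
  every rank `n`, every canonical local Artin datum `art` (`LocalArtinData.IsCanonical`: THE Artin
  map, geometric Frobenius ↦ uniformiser, the normalisation of Gee–Geraghty's `Art_M`), every
  `ρ : Γ_F →ₜ* GL_n(ℚ̄_ℓ)` and `λ : LabelledWeight F ℚ̄_ℓ n`: if `λ` is dominant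
  (`λ_{τ,1} ≥ ⋯ ≥ λ_{τ,n}`) and regular (for every pair of consecutive rows some label `τ` with strict
  inequality), and for some change of frame `g` the representation `g ρ g⁻¹` is upper triangular with
  `i`-th diagonal entry `∏_τ τ(Art_F⁻¹ w)^{-(λ_{τ,n-i} + i)} = ordinaryWeightUnit λ i (art.artin w)`
  (`= χ^λ_{i+1}(w)`, Def. 3.1.2, via `ε ∘ Art_F = ∏_τ τ` on `𝒪_Fˣ`) at EVERY `w` in the inertia
  subgroup of `W_F`, then `𝔇.IsCrystallineFramed ρ`.  The binders are verbatim those of the named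
  fact `GeeGeraghty2012.crystalline_of_ordinary_regular` (file `PAdicHodge/CrystallineOfOrdinaryRegular`). -/
  isCrystallineFramed_of_ordinary_regular :
    ∀ (n : ℕ) (art : LocalArtinData F), art.IsCanonical →
      ∀ (ρ : FramedGaloisRep F (PadicAlgCl ℓ) n) (wt : LabelledWeight F (PadicAlgCl ℓ) n),
        wt.IsDominant →
        (∀ i j : Fin n, (i : ℕ) + 1 = j → ∃ τ : HodgeTateLabel F (PadicAlgCl ℓ), wt τ j < wt τ i) →
        (∃ g : GL (Fin n) (PadicAlgCl ℓ), FramedRep.IsUpperTriangular (ρ.conj g) ∧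
          ∀ w ∈ WeilGroup.inertia F, ∀ i : Fin n,
            FramedRep.diagEntry (ρ.conj g) i (WeilGroup.toAbsGalois F w) =
              (ordinaryWeightUnit wt i (art.artin w) : PadicAlgCl ℓ)) →
        𝔇.IsCrystallineFramed ρ

/-- Under the clauses every `ℚ̄_ℓ`-point of a `𝔇`-crystalline deformation ring of fixed Hodge
type lies on a unique irreducible component of its geometric generic fibre ([BLGGT] §1.4:
"'Connects' is an equivalence relation. (Because `R^□_{𝒪,ρ̄,{H_τ},K'-cris}[1/l]` is formally
smooth.)") — from (F7) by the accepted
`CrystallineGenericFibreRegular.crystallinePointsOnUniqueComponent`; not a clause.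
[cite: BarnetlambEtAl2014, §1.4] [cite: Kisin2007, Thm. 3.3.8] -/
theorem IsFontaineDatum.crystallinePointsOnUniqueComponent {hℓ : valuation F ℓ < 1}
    {𝔇 : PstWeilDeligneData F ℓ} (h : IsFontaineDatum hℓ 𝔇) :
    𝔇.CrystallinePointsOnUniqueComponent :=
  h.crystallineGenericFibreRegular.crystallinePointsOnUniqueComponent

/-- A datum with Fontaine's clauses is not the truncated model `F̂_nr = (B_dR)^{I_F}` (installed
with the canonical `ℚ_ℓ`-structure): the truncated model violates the non-truncation clause (F2)
(accepted `not_cyclotomicWeightNegOne_unramifiedPstWeilDeligneData`). [folklore] -/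
theorem IsFontaineDatum.ne_unramifiedPstWeilDeligneData {hℓ : valuation F ℓ < 1}
    {𝔇 : PstWeilDeligneData F ℓ} (h : IsFontaineDatum hℓ 𝔇) :
    letI := LocalField.padicAlgebra F ℓ hℓ; 𝔇 ≠ unramifiedPstWeilDeligneData F ℓ := by
  letI := LocalField.padicAlgebra F ℓ hℓ
  exact h.cyclotomicWeightNegOne.ne_unramifiedPstWeilDeligneData

/-- Under the clauses the cyclotomic character is `𝔇`-de Rham. [folklore] -/
theorem IsFontaineDatum.isDeRhamFramed_cyclotomic {hℓ : valuation F ℓ < 1}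
    {𝔇 : PstWeilDeligneData F ℓ} (h : IsFontaineDatum hℓ 𝔇) :
    𝔇.IsDeRhamFramed (FramedGaloisRep.cyclotomicPadicAlgCl F ℓ) :=
  h.isCrystallineFramed_cyclotomic.isDeRhamFramed

/-- Under the clauses an unramified `ρ` HAS an attached Weil–Deligne representation (structure
axioms: unramified ⇒ de Rham ⇒ some `r`), and EVERY attached one is `(ρ|_{W_F}, N = 0)` up to
isomorphism ((F8)). [cite: FontaineAsterisque223VIII, §1.3 and §2.3.7] -/
theorem IsFontaineDatum.isWeilDeligneOf_of_isLocallyUnramified {hℓ : valuation F ℓ < 1}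
    {𝔇 : PstWeilDeligneData F ℓ} (h : IsFontaineDatum hℓ 𝔇) {n : ℕ}
    {ρ : FramedRep (absoluteGaloisGroup F) (PadicAlgCl ℓ) n} (hρ : ρ.IsLocallyUnramified) :
    (∃ r, 𝔇.IsWeilDeligneOf ρ r) ∧
      ∀ r, 𝔇.IsWeilDeligneOf ρ r →
        r.IsEquivalent
          (WeilDeligneRep.ofRep (ρ.weilRestrict F) hρ.isUnramifiedRep_weilRestrict.isContinuousRep) :=
  ⟨𝔇.exists_of_isDeRham ρ (𝔇.isDeRhamWith_of_isLocallyUnramified ρ hρ),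
    fun r hr ↦ h.isEquivalent_weilRestrict_of_isLocallyUnramified ρ r hρ hr⟩

omit [CharZero F] in
/-- The trivial rank-`n` representation of `Γ_F` is unramified. [folklore] -/
theorem _root_.Literature.NumberTheory.GaloisRepresentations.FramedRep.isLocallyUnramified_one
    {n : ℕ} : (1 : FramedRep (absoluteGaloisGroup F) (PadicAlgCl ℓ) n).IsLocallyUnramified :=
  fun _ _ ↦ rfl

omit [CharZero F] in
/-- The Weil–Deligne representation `(1|_{W_F}, N = 0)` of the trivial rank-`n` representation
IS the trivial Weil–Deligne representation (accepted `WeilDeligneRep.trivial`).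
[cite: TateCorvallis1979, (4.1.3)] -/
theorem _root_.Literature.NumberTheory.GaloisRepresentations.WeilDeligneRep.ofRep_weilRestrict_one
    {n : ℕ} (hc : WeilGroup.IsContinuousRep
      ((1 : FramedRep (absoluteGaloisGroup F) (PadicAlgCl ℓ) n).weilRestrict F)) :
    WeilDeligneRep.ofRep ((1 : FramedRep (absoluteGaloisGroup F) (PadicAlgCl ℓ) n).weilRestrict F)
        hc = WeilDeligneRep.trivial (PadicAlgCl ℓ) (Fin n → PadicAlgCl ℓ) := by
  have hw : (1 : FramedRep (absoluteGaloisGroup F) (PadicAlgCl ℓ) n).weilRestrict F =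
      Representation.trivial (PadicAlgCl ℓ) (WeilGroup F) (Fin n → PadicAlgCl ℓ) :=
    MonoidHom.ext fun w ↦ LinearMap.ext fun v ↦ by
      rw [FramedRep.weilRestrict_apply_apply, Representation.trivial_apply]
      change Matrix.mulVec ((1 : GL (Fin n) (PadicAlgCl ℓ)) : Matrix (Fin n) (Fin n) (PadicAlgCl ℓ)) v = v
      rw [Units.val_one, Matrix.one_mulVec]
  have key : ∀ (σ σ' : Representation (PadicAlgCl ℓ) (WeilGroup F) (Fin n → PadicAlgCl ℓ))
      (p : WeilGroup.IsContinuousRep σ) (q : WeilGroup.IsContinuousRep σ'),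
      σ = σ' → WeilDeligneRep.ofRep σ p = WeilDeligneRep.ofRep σ' q := by
    rintro _ _ _ _ rfl; rfl
  exact key _ _ hc WeilGroup.isContinuousRep_trivial hw

/-- **The trivial representation, decided by (F8).** Under the clauses every Weil–Deligne
representation attached to the trivial rank-`n` representation `1 : Γ_F →ₜ* GL_n(ℚ̄_ℓ)` is the
trivial one `(1, N = 0)` up to isomorphism, and one is attached — the instance
(`D_cris(ℚ_ℓ^n) = F₀^n`, `φ = σ`) that no argument from (F1)–(F7) decides.
[cite: FontaineAsterisque223VIII, §1.3] -/
theorem IsFontaineDatum.isEquivalent_trivial_of_isWeilDeligneOf_one {hℓ : valuation F ℓ < 1}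
    {𝔇 : PstWeilDeligneData F ℓ} (h : IsFontaineDatum hℓ 𝔇) {n : ℕ}
    {r : WeilDeligneRep F (PadicAlgCl ℓ) (Fin n → PadicAlgCl ℓ)}
    (hr : 𝔇.IsWeilDeligneOf (1 : FramedRep (absoluteGaloisGroup F) (PadicAlgCl ℓ) n) r) :
    r.IsEquivalent (WeilDeligneRep.trivial (PadicAlgCl ℓ) (Fin n → PadicAlgCl ℓ)) := by
  rw [← WeilDeligneRep.ofRep_weilRestrict_one
    FramedRep.isLocallyUnramified_one.isUnramifiedRep_weilRestrict.isContinuousRep]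
  exact (h.isWeilDeligneOf_of_isLocallyUnramified FramedRep.isLocallyUnramified_one).2 r hr

variable (F ℓ) in
/-- **THE `p`-adic Hodge datum of `F` at `ℓ`: Fontaine's `(B_dR(F), WD ∘ D_pst)`.**  The PERIOD RING
is the construction: Hilbert's `ε` ranges only over the data whose `ℚ_ℓ`-structure is the
canonical one and whose period ring IS `bdRPeriodRingData hℓ` (Fontaine's `B_dR(F)`, file
`BdRPeriodRingData`; the subtype is inhabited, accepted `nonempty_pstWeilDeligneData_bdR` — used only
for `Nonempty`) and picks one with the characterising clauses `IsFontaineDatum hℓ` when such a datum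
exists (D1 of the Upgrade path, 2026-08-17).  Hence `fontainePst_𝔅_eq_bdRPeriodRingData` and
`fontainePst_algebra_eq_padicAlgebra` hold UNCONDITIONALLY ("de Rham for THE datum" = Fontaine's
`B_dR`-admissibility of a finite model, a decidable notion), and under the named fact
`FontaineDatumExists` the datum satisfies every clause (`isFontaineDatum_fontainePst`); only its
Weil–Deligne half `IsWeilDeligneOf` remains pinned by specification (relative to ALL data on `B_dR`
with Fontaine's clauses at once; upgraded in place to `WD ∘ D_pst`, definition item D2).
Fontaine 1994, Exp. II §1.5, Exp. III §3 (`B_dR`, de Rham), Exp. VIII §1.3, §2.3.7 (`D_pst`, `WD`);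
Berger 2002, Thm. 0.7.
[cite: FontaineAsterisque223III, Exp. III §3] [cite: FontaineAsterisque223VIII, §2.3.7]
[cite: BergerLaurent2002, Thm. 0.7] -/
def fontainePst (hℓ : valuation F ℓ < 1) : PstWeilDeligneData F ℓ :=
  letI := LocalField.padicAlgebra F ℓ hℓ
  haveI : Fact (¬ IsUnit ((ℓ : ℕ) : integerC F)) := ⟨not_isUnit_natCast_integerC hℓ⟩
  haveI : IsAdicComplete (Ideal.span {((ℓ : ℕ) : integerC F)}) (integerC F) :=
    isAdicComplete_integerC_natCast hℓ
  (@Classical.epsilon _ (nonempty_pstWeilDeligneData_bdR (F := F) (p := ℓ) hℓ)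
    fun 𝔇 => IsFontaineDatum hℓ 𝔇.1).1

/-- **The `ℚ_ℓ`-structure of THE datum is the canonical one — unconditionally** (by construction of
the pin; formerly clause (F1) under `FontaineDatumExists`, cf. `fontainePst_algebra`). [folklore] -/
theorem fontainePst_algebra_eq_padicAlgebra (hℓ : valuation F ℓ < 1) :
    (fontainePst F ℓ hℓ).algebra = LocalField.padicAlgebra F ℓ hℓ := by
  letI := LocalField.padicAlgebra F ℓ hℓ
  haveI : Fact (¬ IsUnit ((ℓ : ℕ) : integerC F)) := ⟨not_isUnit_natCast_integerC hℓ⟩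
  haveI : IsAdicComplete (Ideal.span {((ℓ : ℕ) : integerC F)}) (integerC F) :=
    isAdicComplete_integerC_natCast hℓ
  exact (@Classical.epsilon _ (nonempty_pstWeilDeligneData_bdR (F := F) (p := ℓ) hℓ)
    fun 𝔇 => IsFontaineDatum hℓ 𝔇.1).2.1

/-- **The period ring of THE datum IS Fontaine's `B_dR(F)` — unconditionally**: the accepted
construction `bdRPeriodRingData hℓ` (for the datum's own, canonical, `ℚ_ℓ`-structure; the instance
arguments are the accepted facts `not_isUnit_natCast_integerC`, `isAdicComplete_integerC_natCast`,
any proofs of which may be supplied).  Consequently de Rham-ness for THE datum is genuine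
`B_dR`-admissibility: e.g. unramified, cyclotomic and finite-image representations are de Rham for it
(files `BdRUnramified`, `BdRCyclotomic`, `BdRFiniteImage`) with no appeal to `FontaineDatumExists`.
[cite: FontaineAsterisque223III, Exp. II §1.5 and Exp. III §3] -/
theorem fontainePst_𝔅_eq_bdRPeriodRingData (hℓ : valuation F ℓ < 1)
    [Fact (¬ IsUnit ((ℓ : ℕ) : integerC F))]
    [IsAdicComplete (Ideal.span {((ℓ : ℕ) : integerC F)}) (integerC F)] :
    (fontainePst F ℓ hℓ).𝔅 = (letI := (fontainePst F ℓ hℓ).algebra; bdRPeriodRingData (F := F) (p := ℓ) hℓ) := by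
  letI := LocalField.padicAlgebra F ℓ hℓ
  exact (@Classical.epsilon _ (nonempty_pstWeilDeligneData_bdR (F := F) (p := ℓ) hℓ)
    fun 𝔇 => IsFontaineDatum hℓ 𝔇.1).2.2

/-- **Finite-image representations are de Rham for THE datum — unconditionally** (e.g. the local
components of Artin representations at `v ∣ ℓ`, ramified or not): `fontainePst_𝔅_eq_bdRPeriodRingData`
with the accepted `PstWeilDeligneData.isDeRhamFramed_of_finite_range_of_bdR` (Hilbert 90 over a finite
Galois splitting field, `F̄ ↪ B_dR⁺`, Fontaine's inequality; Fontaine 1994 Exp. III §1.5, §3;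
Fontaine–Mazur 1995 §1). [cite: FontaineAsterisque223III, Exp. III §1.5 and §3]
[cite: FontaineMazurGeometric1995, §1] -/
theorem fontainePst_isDeRhamFramed_of_finite_range (hℓ : valuation F ℓ < 1) {n : ℕ}
    (ρ : FramedRep (absoluteGaloisGroup F) (PadicAlgCl ℓ) n) (hρ : (Set.range ρ).Finite) :
    (fontainePst F ℓ hℓ).IsDeRhamFramed ρ := by
  haveI : Fact (¬ IsUnit ((ℓ : ℕ) : integerC F)) := ⟨not_isUnit_natCast_integerC hℓ⟩
  haveI : IsAdicComplete (Ideal.span {((ℓ : ℕ) : integerC F)}) (integerC F) :=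
    isAdicComplete_integerC_natCast hℓ
  exact PstWeilDeligneData.isDeRhamFramed_of_finite_range_of_bdR hℓ _
    (fontainePst_𝔅_eq_bdRPeriodRingData hℓ) ρ hρ

end Local

/-- **Fontaine's construction (existence of the genuine datum)** — NAMED FACT (D-0014), the T0
build debt of the pin: for every characteristic-`0` non-archimedean local field `F` of residue
characteristic `ℓ` there is a `p`-adic Hodge datum with Fontaine's characterising clauses
`IsFontaineDatum` — namely `𝔅 = B_dR(F)` (Fontaine 1994, Exp. II §1.5, Exp. III §1.5, §3;
`B_dR^{Γ_F} = F` by Ax–Sen–Tate), `IsWeilDeligneOf ρ r :⇔ r ≅ WD(D_pst(ρ))` (Exp. VIII §1.3,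
§2.3.7), whose structure axioms are Berger 2002 Thm. 0.7 (de Rham ⇒ potentially semistable) and
Fontaine's computations in the unramified case, for which (F2)–(F4) and (F8) are Fontaine's
theorems (`D_dR(ℚ_ℓ(1)) = F · t⁻¹`, `ℚ_ℓ(1)` crystalline, unramified ⇒ crystalline of weight `0`
with `WD(D_pst ρ) ≅ (ρ|_{W_F}, N = 0)`, Exp. VIII §1.3, §2.3.7) and (F5)–(F7) are Kisin's
(existence of the crystalline deformation rings `R^{□,v}_{cr}` and of their interval form,
Cor. (2.7.7), (3.3.3); regular equidimensional generic fibre, Thm. (3.3.8)).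
Discharging this fact honestly IS the construction (definition item
`defn-FontainePstWeilDeligneData`, components (ii)–(iii)) followed by the verification of the
clauses for it — for (F5)–(F7) the formalisation of Kisin 2008 for the constructed datum; a
discharge by an exotic model would be formally admissible but is to be flagged by reviewers (see
the module docstring).
[cite: FontaineAsterisque223III, Exp. III §1.5 and §3] [cite: FontaineAsterisque223VIII, §2.3.7]
For (F10) it is Fontaine's `B_cris`-tower `K' ↦ B_cris(K')` with the compatibilities recorded by
the accepted interface `PstCrystallineExtensionData` (Exp. III §5.1, Exp. VIII §1.3, §2.3.7;
Berger 2002 Thm. 0.7; Brinon–Conrad Prop. 9.1.9; [BLGGT] §1.4 p. 13).  For (F11) it is Fontaine's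
computation `D_dR(ℚ_ℓ(m)) = F · t^{-m}` (Exp. III §1.5.4–1.5.5), `HT_τ(ε^m) = {-m}` ([BLGGT]
Notation; Buzzard–Gee 2014 §2.4).  For (F12) (vacuous unless `[F : ℚ_ℓ] = 1`) it is the theorem
that the determinant of a crystalline representation of `Γ_{ℚ_ℓ}` is a crystalline character of the
sum weight (Brinon–Conrad §9.1 p. 133, Prop. 9.1.11), hence `ψ · ε^{-Σ HT}` with `ψ` unramified
(Prop. 8.3.4, Exercise 8.4.3 (1); Conrad 2011, Prop. B.4), "crystalline" being de Rham with
`WD ∘ D_pst` unramified and `N = 0` (Exp. VIII §2.3.7).  For (F13) (vacuous unless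
`[F : ℚ_ℓ] = 1`) it is Fontaine–Laffaille theory for `K = ℚ_ℓ` in the covariant normalisation:
every lattice in a crystalline representation with weights in `[w₀, w₀ + ℓ − 2]` is `G_K` of a
Fontaine–Laffaille module with `FL = HT`, the essential image being closed under subquotients
(Fontaine–Laffaille 1982 Thm. 6.1, Thm. 8.4; CHT 2008 §2.4.1; BLGGT 2014 §1.4), tame inertia acting
on the simple objects through the digits (FL82 Prop. 4.4, Thm. 5.3 (iii)), rank-two extensions
computed by CHT Lemma 2.4.2 and peu ramifiés by Gee–Herzig–Liu–Savitt 2017 Prop. 2.3.1.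
[cite: FontaineLaffaille1982, Thm. 5.3, Thm. 6.1 and Thm. 8.4] [cite: GeeHerzigLiuSavitt2017, Prop. 2.3.1]
[cite: BergerLaurent2002, Thm. 0.7] [cite: Kisin2007, Cor. 2.7.7, (3.3.3) and Thm. 3.3.8]
[cite: FontaineAsterisque223III, Exp. III §5.1] [cite: BrinonConrad2009, Prop. 9.1.9]
[cite: BrinonConrad2009, Prop. 8.3.4 and Prop. 9.1.11] [cite: Conrad2011LiftingGlobal, Appendix B, Prop. B.4] -/
def FontaineDatumExists : Prop :=
  ∀ (F : Type) [Field F] [ValuativeRel F] [TopologicalSpace F] [IsNonarchimedeanLocalField F]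
    [CharZero F] (ℓ : ℕ) [Fact ℓ.Prime] (hℓ : valuation F ℓ < 1),
    ∃ 𝔇 : PstWeilDeligneData F ℓ, IsFontaineDatum hℓ 𝔇

section LocalConsequences

variable {F : Type} [Field F] [ValuativeRel F] [TopologicalSpace F] [IsNonarchimedeanLocalField F]
  [CharZero F] {ℓ : ℕ} [Fact ℓ.Prime]

/-- Under Fontaine's existence theorem the pinned datum satisfies every characterising clause
(`Classical.epsilon_spec` over the data on `B_dR`: a datum with the clauses has the canonical
`ℚ_ℓ`-structure (F1) and period ring `B_dR` (F9), so it lies in the subtype `ε` ranges over).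
[folklore] -/
theorem isFontaineDatum_fontainePst (h : FontaineDatumExists) (hℓ : valuation F ℓ < 1) :
    IsFontaineDatum hℓ (fontainePst F ℓ hℓ) := by
  letI := LocalField.padicAlgebra F ℓ hℓ
  haveI : Fact (¬ IsUnit ((ℓ : ℕ) : integerC F)) := ⟨not_isUnit_natCast_integerC hℓ⟩
  haveI : IsAdicComplete (Ideal.span {((ℓ : ℕ) : integerC F)}) (integerC F) :=
    isAdicComplete_integerC_natCast hℓ
  obtain ⟨𝔇, h𝔇⟩ := h F ℓ hℓ
  exact @Classical.epsilon_spec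
    {𝔇 : PstWeilDeligneData F ℓ // 𝔇.algebra = LocalField.padicAlgebra F ℓ hℓ ∧
      𝔇.𝔅 = (letI := 𝔇.algebra; bdRPeriodRingData (F := F) (p := ℓ) hℓ)}
    (fun 𝔇 => IsFontaineDatum hℓ 𝔇.1) ⟨⟨𝔇, h𝔇.algebra_eq, h𝔇.periodRing_eq_bdR⟩, h𝔇⟩

/-- The pinned datum carries the CANONICAL `ℚ_ℓ`-algebra structure of `F` (under
`FontaineDatumExists`). [folklore] -/
theorem fontainePst_algebra (h : FontaineDatumExists) (hℓ : valuation F ℓ < 1) :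
    (fontainePst F ℓ hℓ).algebra = LocalField.padicAlgebra F ℓ hℓ :=
  (isFontaineDatum_fontainePst h hℓ).algebra_eq

/-- The pinned datum is not the truncated model `F̂_nr` (under `FontaineDatumExists`). [folklore] -/
theorem fontainePst_ne_unramifiedPstWeilDeligneData (h : FontaineDatumExists)
    (hℓ : valuation F ℓ < 1) :
    letI := LocalField.padicAlgebra F ℓ hℓ
    fontainePst F ℓ hℓ ≠ unramifiedPstWeilDeligneData F ℓ :=
  (isFontaineDatum_fontainePst h hℓ).ne_unramifiedPstWeilDeligneData

/-- For the pinned datum the cyclotomic character is de Rham of weight `-1` and crystalline, and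
unramified representations have weights `0` (under `FontaineDatumExists`). [folklore] -/
theorem fontainePst_clauses (h : FontaineDatumExists) (hℓ : valuation F ℓ < 1) :
    (fontainePst F ℓ hℓ).CyclotomicWeightNegOne ∧ (fontainePst F ℓ hℓ).UnramifiedWeightsZero ∧
      (fontainePst F ℓ hℓ).IsCrystallineFramed (FramedGaloisRep.cyclotomicPadicAlgCl F ℓ) :=
  ⟨(isFontaineDatum_fontainePst h hℓ).cyclotomicWeightNegOne,
    (isFontaineDatum_fontainePst h hℓ).unramifiedWeightsZero,
    (isFontaineDatum_fontainePst h hℓ).isCrystallineFramed_cyclotomic⟩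

/-- **Kisin's theorems for THE datum** (under `FontaineDatumExists`, clauses (F5)–(F7)): the
`fontainePst`-crystalline deformation rings with weights in an interval and of every labelled
Hodge type exist, and the latter have regular generic fibres, equidimensional of dimension
`n² + Σ_τ hodgeTypeFlagDim (v τ)` (Kisin 2008, Cor. (2.7.7), (3.3.3), Thm. (3.3.8)).
[cite: Kisin2007, Cor. 2.7.7, (3.3.3) and Thm. 3.3.8] [cite: BarnetlambEtAl2014, §1.4] -/
theorem fontainePst_kisin (h : FontaineDatumExists) (hℓ : valuation F ℓ < 1) :
    (fontainePst F ℓ hℓ).HasCrystallineDeformationRings ∧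
      (fontainePst F ℓ hℓ).HasHodgeTypeCrystallineDeformationRings ∧
        (fontainePst F ℓ hℓ).CrystallineGenericFibreRegular :=
  ⟨(isFontaineDatum_fontainePst h hℓ).hasCrystallineDeformationRings,
    (isFontaineDatum_fontainePst h hℓ).hasHodgeTypeCrystallineDeformationRings,
    (isFontaineDatum_fontainePst h hℓ).crystallineGenericFibreRegular⟩

/-- **(F8) for THE datum** (under `FontaineDatumExists`): an unramified `ρ` has a Weil–Deligne
representation attached by `fontainePst`, and every attached one is `(ρ|_{W_F}, N = 0)` up to
isomorphism (Fontaine 1994, Exp. VIII §1.3, §2.3.7). [cite: FontaineAsterisque223VIII, §2.3.7] -/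
theorem fontainePst_isWeilDeligneOf_of_isLocallyUnramified (h : FontaineDatumExists)
    (hℓ : valuation F ℓ < 1) {n : ℕ} {ρ : FramedRep (absoluteGaloisGroup F) (PadicAlgCl ℓ) n}
    (hρ : ρ.IsLocallyUnramified) :
    (∃ r, (fontainePst F ℓ hℓ).IsWeilDeligneOf ρ r) ∧
      ∀ r, (fontainePst F ℓ hℓ).IsWeilDeligneOf ρ r →
        r.IsEquivalent
          (WeilDeligneRep.ofRep (ρ.weilRestrict F) hρ.isUnramifiedRep_weilRestrict.isContinuousRep) :=
  (isFontaineDatum_fontainePst h hℓ).isWeilDeligneOf_of_isLocallyUnramified hρ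

/-- For THE datum every Weil–Deligne representation attached to the trivial rank-`n`
representation is trivial up to isomorphism (under `FontaineDatumExists`; from (F8)).
[cite: FontaineAsterisque223VIII, §1.3] -/
theorem fontainePst_isEquivalent_trivial_of_isWeilDeligneOf_one (h : FontaineDatumExists)
    (hℓ : valuation F ℓ < 1) {n : ℕ} {r : WeilDeligneRep F (PadicAlgCl ℓ) (Fin n → PadicAlgCl ℓ)}
    (hr : (fontainePst F ℓ hℓ).IsWeilDeligneOf
      (1 : FramedRep (absoluteGaloisGroup F) (PadicAlgCl ℓ) n) r) :
    r.IsEquivalent (WeilDeligneRep.trivial (PadicAlgCl ℓ) (Fin n → PadicAlgCl ℓ)) :=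
  (isFontaineDatum_fontainePst h hℓ).isEquivalent_trivial_of_isWeilDeligneOf_one hr

/-- For THE datum every `ℚ̄_ℓ`-point of a crystalline deformation ring of fixed Hodge type lies on
a unique irreducible component of the geometric generic fibre, so that "'connects' is an
equivalence relation" ([BLGGT] §1.4; under `FontaineDatumExists`, from (F7)).
[cite: BarnetlambEtAl2014, §1.4] -/
theorem fontainePst_pointsOnUniqueComponent (h : FontaineDatumExists)
    (hℓ : valuation F ℓ < 1) : (fontainePst F ℓ hℓ).CrystallinePointsOnUniqueComponent :=
  (isFontaineDatum_fontainePst h hℓ).crystallinePointsOnUniqueComponent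

/-- **(F10) for THE datum** (under `FontaineDatumExists`): compatible crystalline extension data
over `fontainePst F ℓ hℓ` exist (Fontaine's `B_cris`-tower; Exp. III §5.1, Exp. VIII §2.3.7,
Berger 2002 Thm. 0.7, Brinon–Conrad Prop. 9.1.9, [BLGGT] §1.4).
[cite: FontaineAsterisque223III, Exp. III §5.1] [cite: BarnetlambEtAl2014, §1.4] -/
theorem fontainePst_nonempty_pstCrystallineExtensionData (h : FontaineDatumExists)
    (hℓ : valuation F ℓ < 1) : Nonempty (PstCrystallineExtensionData (fontainePst F ℓ hℓ)) :=
  (isFontaineDatum_fontainePst h hℓ).nonempty_pstCrystallineExtensionData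

/-- **The powers of the cyclotomic character have labelled Hodge–Tate weights `{-m}` for THE
datum** (clause (F11), under `FontaineDatumExists`): `HT_τ(ε^m) = {-m}` relative to
`(fontainePst F ℓ hℓ).𝔅 = B_dR(F)` for every `m : ℤ`, every rank-one framed `χ` with entries
`ε_F^m` and every `ℚ_ℓ`-embedding `τ : F → ℚ̄_ℓ` (Fontaine 1994, Exp. III §1.5:
`D_dR(ℚ_ℓ(m)) = F · t^{-m}`; [BLGGT] Notation; Buzzard–Gee 2014 §2.4).
[cite: FontaineAsterisque223III, Exp. III §1.5] [cite: BuzzardGeeLMS2014, §2.4] -/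
theorem fontainePst_cyclotomicPowersLabelledWeights (h : FontaineDatumExists)
    (hℓ : valuation F ℓ < 1) : (fontainePst F ℓ hℓ).CyclotomicPowersLabelledWeights :=
  (isFontaineDatum_fontainePst h hℓ).cyclotomicPowersLabelledWeights

/-- **The determinant of a crystalline representation on inertia for THE datum** (clause (F12),
under `FontaineDatumExists`): if the canonical `ℚ_ℓ`-structure makes `ℚ_ℓ → F` surjective
(`[F : ℚ_ℓ] = 1`), every `fontainePst`-crystalline framed `ρ : Γ_F →ₜ* GL_n(ℚ̄_ℓ)` has
`det ρ(σ) = ε_F(σ)^{-Σ HT_τ(ρ)}` on `I_F`, the weights read off `(fontainePst F ℓ hℓ).𝔅 = B_dR(F)`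
(Brinon–Conrad Prop. 8.3.4, §9.1 p. 133, Prop. 9.1.11; Conrad 2011, Prop. B.4).
[cite: BrinonConrad2009, Prop. 8.3.4 and Prop. 9.1.11] [cite: Conrad2011LiftingGlobal, Appendix B, Prop. B.4] -/
theorem fontainePst_crystallineDetOnInertia (h : FontaineDatumExists) (hℓ : valuation F ℓ < 1) :
    (fontainePst F ℓ hℓ).CrystallineDetOnInertia :=
  (isFontaineDatum_fontainePst h hℓ).crystallineDetOnInertia

/-- **Fontaine–Laffaille reductions for THE datum** (clause (F13), under `FontaineDatumExists`):
over a degree-one base, the reductions of `fontainePst`-crystalline representations with weights in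
an interval of length `≤ ℓ − 2` have Fontaine–Laffaille tame inertia weights `= HT` and correctly
ordered / peu ramifié rank-two subquotients (Fontaine–Laffaille 1982; CHT 2008 §2.4.1; GHLS 2017
Prop. 2.3.1). [cite: FontaineLaffaille1982, Prop. 4.4 and Thm. 5.3 (iii)]
[cite: ClozelHarrisTaylor2008, §2.4.1 and Lemma 2.4.2] [cite: GeeHerzigLiuSavitt2017, Prop. 2.3.1] -/
theorem fontainePst_fontaineLaffailleReductions (h : FontaineDatumExists) (hℓ : valuation F ℓ < 1) :
    (fontainePst F ℓ hℓ).FontaineLaffailleReductions :=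
  (isFontaineDatum_fontainePst h hℓ).fontaineLaffailleReductions

/-- **Gee–Geraghty 2012, Lemma 3.1.4 (3), for THE datum** (clause (F14), under
`FontaineDatumExists`): a `ρ : Γ_F →ₜ* GL_n(ℚ̄_ℓ)` which, after a change of frame, is upper
triangular with `i`-th diagonal entry `∏_τ τ(Art_F⁻¹ w)^{-(λ_{τ,n-i} + i)} = χ^λ_{i+1}(w)` at every
`w` in the inertia subgroup of `W_F` (canonical Artin datum `art`), for a dominant REGULAR labelled
weight `λ`, is crystalline for `fontainePst F ℓ hℓ` — "If each `ψ_j` is crystalline and `λ` is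
regular, then `ρ` is crystalline". [cite: GeeGeraghty2012, Def. 3.1.2 and Lemma 3.1.4 (3)] -/
theorem fontainePst_isCrystallineFramed_of_ordinary_regular (h : FontaineDatumExists)
    (hℓ : valuation F ℓ < 1) {n : ℕ} (art : LocalArtinData F) (hart : art.IsCanonical)
    (ρ : FramedGaloisRep F (PadicAlgCl ℓ) n) (wt : LabelledWeight F (PadicAlgCl ℓ) n)
    (hdom : wt.IsDominant)
    (hreg : ∀ i j : Fin n, (i : ℕ) + 1 = j → ∃ τ : HodgeTateLabel F (PadicAlgCl ℓ), wt τ j < wt τ i)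
    (hord : ∃ g : GL (Fin n) (PadicAlgCl ℓ), FramedRep.IsUpperTriangular (ρ.conj g) ∧
        ∀ w ∈ WeilGroup.inertia F, ∀ i : Fin n,
          FramedRep.diagEntry (ρ.conj g) i (WeilGroup.toAbsGalois F w) =
            (ordinaryWeightUnit wt i (art.artin w) : PadicAlgCl ℓ)) :
    (fontainePst F ℓ hℓ).IsCrystallineFramed ρ :=
  (isFontaineDatum_fontainePst h hℓ).isCrystallineFramed_of_ordinary_regular n art hart ρ wt hdom
    hreg hord

end LocalConsequences

/-! ### The datum of the summit: `F = K_v`, `v ∣ ℓ` -/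

section NumberField

variable {K : Type} [Field K] [NumberField K]

/-- **The `p`-adic Hodge datum of the summit statement `Langlands` at a place `v ∣ ℓ`** of the
number field `K`: Fontaine's `(B_dR(K_v), WD ∘ D_pst)` for the local field `K_v = v.adicCompletion K`
(accepted instance `instIsNonarchimedeanLocalFieldAdicCompletion`; `K_v` has characteristic `0`,
accepted `LocalField.charZero_adicCompletion`, and `|ℓ|_v < 1`, accepted
`LocalField.valuation_adicCompletion_natCast_lt_one`), i.e. `fontainePst (K_v) ℓ _`. This is the
term `Summit.Langlands.ReciprocityData.pst` denotes (D-0018 L2, pinned 2026-08-16).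
[cite: FontaineAsterisque223III, Exp. III §3] [cite: FontaineMazurGeometric1995, §1] -/
def fontainePstAdicCompletion (v : HeightOneSpectrum (𝓞 K)) (ℓ : ℕ) [Fact ℓ.Prime]
    (hv : ((ℓ : ℕ) : 𝓞 K) ∈ v.asIdeal) : PstWeilDeligneData (v.adicCompletion K) ℓ :=
  haveI := LocalField.charZero_adicCompletion v
  fontainePst (v.adicCompletion K) ℓ (LocalField.valuation_adicCompletion_natCast_lt_one v ℓ hv)

/-- The summit's datum satisfies Fontaine's clauses (under `FontaineDatumExists`); in particular
its `ℚ_ℓ`-structure on `K_v` is the canonical `LocalField.adicCompletionPadicAlgebra v ℓ hv`.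
[folklore] -/
theorem isFontaineDatum_fontainePstAdicCompletion (h : FontaineDatumExists)
    (v : HeightOneSpectrum (𝓞 K)) (ℓ : ℕ) [Fact ℓ.Prime] (hv : ((ℓ : ℕ) : 𝓞 K) ∈ v.asIdeal) :
    haveI := LocalField.charZero_adicCompletion v
    IsFontaineDatum (LocalField.valuation_adicCompletion_natCast_lt_one v ℓ hv)
      (fontainePstAdicCompletion v ℓ hv) := by
  haveI := LocalField.charZero_adicCompletion v
  exact isFontaineDatum_fontainePst h _

/-- The summit's datum carries the canonical `ℚ_ℓ`-algebra structure of `K_v` (under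
`FontaineDatumExists`). [folklore] -/
theorem fontainePstAdicCompletion_algebra (h : FontaineDatumExists)
    (v : HeightOneSpectrum (𝓞 K)) (ℓ : ℕ) [Fact ℓ.Prime] (hv : ((ℓ : ℕ) : 𝓞 K) ∈ v.asIdeal) :
    (fontainePstAdicCompletion v ℓ hv).algebra = LocalField.adicCompletionPadicAlgebra v ℓ hv := by
  haveI := LocalField.charZero_adicCompletion v
  exact (isFontaineDatum_fontainePstAdicCompletion h v ℓ hv).algebra_eq

/-- **Compatible crystalline extension data over the summit's datum at `v ∣ ℓ` exist** (clause
(F10), under `FontaineDatumExists`): `PstCrystallineExtensionData (fontainePstAdicCompletion v ℓ hv)`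
is inhabited — Fontaine's tower `K' ↦ B_cris(K')` over `K_v` (Exp. III §5.1, Exp. VIII §2.3.7;
Berger 2002 Thm. 0.7; Brinon–Conrad Prop. 9.1.9; [BLGGT] §1.4 p. 13).  This is the statement of
the route child `PinnedCrystallineExtensionDataExists` of `Langlands/WachComponentCensus`, which
makes its `∀ 𝔈 : PstCrystallineExtensionData (RD.pst p v hv)`-items non-vacuous.
[cite: FontaineAsterisque223III, Exp. III §5.1] [cite: BarnetlambEtAl2014, §1.4] -/
theorem nonempty_pstCrystallineExtensionData_fontainePstAdicCompletion (h : FontaineDatumExists)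
    (v : HeightOneSpectrum (𝓞 K)) (ℓ : ℕ) [Fact ℓ.Prime] (hv : ((ℓ : ℕ) : 𝓞 K) ∈ v.asIdeal) :
    Nonempty (PstCrystallineExtensionData (fontainePstAdicCompletion v ℓ hv)) := by
  haveI := LocalField.charZero_adicCompletion v
  exact (isFontaineDatum_fontainePst h
    (LocalField.valuation_adicCompletion_natCast_lt_one v ℓ hv)).nonempty_pstCrystallineExtensionData

/-- **`HT_τ(ε^m) = {-m}` for the summit's datum at `v ∣ ℓ`** (clause (F11), under
`FontaineDatumExists`): the powers of the cyclotomic character of `Γ_{K_v}` have labelled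
Hodge–Tate weights `{-m}` relative to `(fontainePstAdicCompletion v ℓ hv).𝔅 = B_dR(K_v)` — the pin
conjunct of the `∃ RD`-slices of `Langlands/WachComponentCensus` and `Langlands/TriangulineChamber`
(their reductions `pin_of_localPin`, `pin_of_localClause`), i.e. the route child
`PinnedCyclotomicPowersWeights`. [cite: FontaineAsterisque223III, Exp. III §1.5]
[cite: BarnetlambEtAl2014, Introduction (Notation)] [cite: BuzzardGeeLMS2014, §2.4] -/
theorem cyclotomicPowersLabelledWeights_fontainePstAdicCompletion (h : FontaineDatumExists)
    (v : HeightOneSpectrum (𝓞 K)) (ℓ : ℕ) [Fact ℓ.Prime] (hv : ((ℓ : ℕ) : 𝓞 K) ∈ v.asIdeal) :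
    (fontainePstAdicCompletion v ℓ hv).CyclotomicPowersLabelledWeights := by
  haveI := LocalField.charZero_adicCompletion v
  exact (isFontaineDatum_fontainePst h
    (LocalField.valuation_adicCompletion_natCast_lt_one v ℓ hv)).cyclotomicPowersLabelledWeights

/-- **`det ρ|_{I_{K_v}} = ε^{-Σ HT_τ(ρ)}` for crystalline `ρ` and the summit's datum at a place
`v ∣ ℓ` of degree one** (clause (F12), under `FontaineDatumExists`): if the `ℚ_ℓ`-structure of
`fontainePstAdicCompletion v ℓ hv` (the canonical one, `fontainePstAdicCompletion_algebra_eq_adicCompletionPadicAlgebra`)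
makes `ℚ_ℓ → K_v` surjective — e.g. `ℓ` split in a quadratic field — then every crystalline framed
`ρ : Γ_{K_v} →ₜ* GL_n(ℚ̄_ℓ)` has `det ρ(σ) = ε_{K_v}(σ)^{-Σ HT_τ(ρ)}` for `σ ∈ absInertia (K_v)`.
This is what stub S1 `stub_pinnedCrystallineDetLocal` of crux `stmt-Langlands-17008`
(`NonParallelVoid.EmptyWeightCore`) specialises (`labelledHodgeTateWeightsAt_def`,
`CrystallineDetOnInertia.det_eq_of_labelledHodgeTateWeights_eq_pair`).
[cite: BrinonConrad2009, Prop. 8.3.4 and Prop. 9.1.11] [cite: Conrad2011LiftingGlobal, Appendix B, Prop. B.4] -/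
theorem crystallineDetOnInertia_fontainePstAdicCompletion (h : FontaineDatumExists)
    (v : HeightOneSpectrum (𝓞 K)) (ℓ : ℕ) [Fact ℓ.Prime] (hv : ((ℓ : ℕ) : 𝓞 K) ∈ v.asIdeal) :
    (fontainePstAdicCompletion v ℓ hv).CrystallineDetOnInertia := by
  haveI := LocalField.charZero_adicCompletion v
  exact (isFontaineDatum_fontainePst h
    (LocalField.valuation_adicCompletion_natCast_lt_one v ℓ hv)).crystallineDetOnInertia

/-- **Fontaine–Laffaille reductions for the summit's datum at a place `v ∣ ℓ`** (clause (F13), under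
`FontaineDatumExists`): whenever `ℚ_ℓ → K_v` is surjective for the datum's (canonical)
`ℚ_ℓ`-structure — e.g. `K = ℚ`, or `ℓ` split — the reductions of crystalline framed
`ρ : Γ_{K_v} →ₜ* GL_n(ℚ̄_ℓ)` with labelled weights in `[w₀, w₀ + ℓ − 2]` have Fontaine–Laffaille tame
inertia weights `= HT` and correctly ordered / peu ramifié rank-two subquotients.  This is what stub
`stub_localFL` of crux `stmt-Langlands-16779` reads the Serre weight of its seed off.
[cite: FontaineLaffaille1982, Prop. 4.4 and Thm. 5.3 (iii)] [cite: GeeHerzigLiuSavitt2017, Prop. 2.3.1] -/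
theorem fontaineLaffailleReductions_fontainePstAdicCompletion (h : FontaineDatumExists)
    (v : HeightOneSpectrum (𝓞 K)) (ℓ : ℕ) [Fact ℓ.Prime] (hv : ((ℓ : ℕ) : 𝓞 K) ∈ v.asIdeal) :
    (fontainePstAdicCompletion v ℓ hv).FontaineLaffailleReductions := by
  haveI := LocalField.charZero_adicCompletion v
  exact (isFontaineDatum_fontainePst h
    (LocalField.valuation_adicCompletion_natCast_lt_one v ℓ hv)).fontaineLaffailleReductions

/-- **Gee–Geraghty 2012, Lemma 3.1.4 (3), for the summit's datum at a place `v ∣ ℓ`** (clause (F14),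
under `FontaineDatumExists`): a `ρ_v : Γ_{K_v} →ₜ* GL_n(ℚ̄_ℓ)` which is ordinary of a dominant regular
labelled weight with diagonal characters `χ^λ_j` on all of inertia (canonical Artin datum of `K_v`) is
crystalline for `fontainePstAdicCompletion v ℓ hv` — the shape consumed at `u ∣ ℓ` by the ordinary
points of line `thorne-minimal-lift` of crux `stmt-Langlands-13757` (cf.
`GeeGeraghty2012.crystalline_of_ordinary_regular_at`). [cite: GeeGeraghty2012, Lemma 3.1.4 (3)] -/
theorem isCrystallineFramed_of_ordinary_regular_fontainePstAdicCompletion (h : FontaineDatumExists)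
    (v : HeightOneSpectrum (𝓞 K)) (ℓ : ℕ) [Fact ℓ.Prime] (hv : ((ℓ : ℕ) : 𝓞 K) ∈ v.asIdeal) {n : ℕ}
    (art : LocalArtinData (v.adicCompletion K)) (hart : art.IsCanonical)
    (ρv : FramedGaloisRep (v.adicCompletion K) (PadicAlgCl ℓ) n)
    (wt : LabelledWeight (v.adicCompletion K) (PadicAlgCl ℓ) n) (hdom : wt.IsDominant)
    (hreg : ∀ i j : Fin n, (i : ℕ) + 1 = j →
      ∃ τ : HodgeTateLabel (v.adicCompletion K) (PadicAlgCl ℓ), wt τ j < wt τ i)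
    (hord : ∃ g : GL (Fin n) (PadicAlgCl ℓ), FramedRep.IsUpperTriangular (ρv.conj g) ∧
        ∀ w ∈ WeilGroup.inertia (v.adicCompletion K), ∀ i : Fin n,
          FramedRep.diagEntry (ρv.conj g) i (WeilGroup.toAbsGalois (v.adicCompletion K) w) =
            (ordinaryWeightUnit wt i (art.artin w) : PadicAlgCl ℓ)) :
    (fontainePstAdicCompletion v ℓ hv).IsCrystallineFramed ρv := by
  haveI := LocalField.charZero_adicCompletion v
  exact fontainePst_isCrystallineFramed_of_ordinary_regular h
    (LocalField.valuation_adicCompletion_natCast_lt_one v ℓ hv) art hart ρv wt hdom hreg hord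

/-- **The summit's datum carries the canonical `ℚ_ℓ`-algebra structure of `K_v` — unconditionally**
(by construction of the pin, `fontainePst_algebra_eq_padicAlgebra`). [folklore] -/
theorem fontainePstAdicCompletion_algebra_eq_adicCompletionPadicAlgebra
    (v : HeightOneSpectrum (𝓞 K)) (ℓ : ℕ) [Fact ℓ.Prime] (hv : ((ℓ : ℕ) : 𝓞 K) ∈ v.asIdeal) :
    (fontainePstAdicCompletion v ℓ hv).algebra = LocalField.adicCompletionPadicAlgebra v ℓ hv := by
  haveI := LocalField.charZero_adicCompletion v
  exact fontainePst_algebra_eq_padicAlgebra _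

/-- **The period ring of the summit's datum at `v ∣ ℓ` IS Fontaine's `B_dR(K_v)` — unconditionally**:
the accepted construction `bdRPeriodRingData` for `K_v` (`fontainePst_𝔅_eq_bdRPeriodRingData`; the
instance arguments are the accepted facts `LocalField.charZero_adicCompletion`,
`not_isUnit_natCast_integerC`, `isAdicComplete_integerC_natCast`, any proofs of which may be supplied).
[cite: FontaineAsterisque223III, Exp. II §1.5 and Exp. III §3] -/
theorem fontainePstAdicCompletion_𝔅_eq_bdRPeriodRingData
    (v : HeightOneSpectrum (𝓞 K)) (ℓ : ℕ) [Fact ℓ.Prime] (hv : ((ℓ : ℕ) : 𝓞 K) ∈ v.asIdeal)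
    [CharZero (v.adicCompletion K)] [Fact (¬ IsUnit ((ℓ : ℕ) : integerC (v.adicCompletion K)))]
    [IsAdicComplete (Ideal.span {((ℓ : ℕ) : integerC (v.adicCompletion K))})
      (integerC (v.adicCompletion K))] :
    (fontainePstAdicCompletion v ℓ hv).𝔅 =
      (letI := (fontainePstAdicCompletion v ℓ hv).algebra
       bdRPeriodRingData (F := v.adicCompletion K) (p := ℓ)
         (LocalField.valuation_adicCompletion_natCast_lt_one v ℓ hv)) :=
  fontainePst_𝔅_eq_bdRPeriodRingData _

/-- **Finite-image local representations are de Rham for the summit's datum at `v ∣ ℓ` —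
unconditionally** (e.g. the local components at `v ∣ ℓ` of Artin representations, ramified or not;
`fontainePst_isDeRhamFramed_of_finite_range`). [cite: FontaineAsterisque223III, Exp. III §1.5 and §3]
[cite: FontaineMazurGeometric1995, §1] -/
theorem fontainePstAdicCompletion_isDeRhamFramed_of_finite_range
    (v : HeightOneSpectrum (𝓞 K)) (ℓ : ℕ) [Fact ℓ.Prime] (hv : ((ℓ : ℕ) : 𝓞 K) ∈ v.asIdeal) {n : ℕ}
    (ρ : FramedRep (absoluteGaloisGroup (v.adicCompletion K)) (PadicAlgCl ℓ) n)
    (hρ : (Set.range ρ).Finite) :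
    (fontainePstAdicCompletion v ℓ hv).IsDeRhamFramed ρ := by
  haveI := LocalField.charZero_adicCompletion v
  exact fontainePst_isDeRhamFramed_of_finite_range _ ρ hρ

end NumberField

/-- **The route child `PinnedCrystallineExtensionDataExists`, verbatim, under `FontaineDatumExists`**
(clause (F10) of the pin at every place `v ∣ p` of every number field): for THE pinned datum
`fontainePstAdicCompletion v p hv` of the summit, compatible crystalline extension data exist.
[cite: FontaineAsterisque223III, Exp. III §5.1] [cite: BarnetlambEtAl2014, §1.4] -/
theorem FontaineDatumExists.pinnedCrystallineExtensionDataExists (h : FontaineDatumExists) :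
    ∀ (F : Type) [Field F] [NumberField F] (p : ℕ) [Fact p.Prime]
      (v : HeightOneSpectrum (𝓞 F)) (hv : ((p : ℕ) : 𝓞 F) ∈ v.asIdeal),
      Nonempty (PstCrystallineExtensionData (fontainePstAdicCompletion v p hv)) :=
  fun _ _ _ p _ v hv => nonempty_pstCrystallineExtensionData_fontainePstAdicCompletion h v p hv

/-- **The route child `PinnedCyclotomicPowersWeights`, verbatim, under `FontaineDatumExists`**
(clause (F11) of the pin at every place `v ∣ p` of every number field): for THE pinned datum
`fontainePstAdicCompletion v p hv` of the summit, the powers of the cyclotomic character have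
labelled Hodge–Tate weights `{-m}`. [cite: FontaineAsterisque223III, Exp. III §1.5]
[cite: BarnetlambEtAl2014, Introduction (Notation)] [cite: BuzzardGeeLMS2014, §2.4] -/
theorem FontaineDatumExists.pinnedCyclotomicPowersWeights (h : FontaineDatumExists) :
    ∀ (F : Type) [Field F] [NumberField F] (p : ℕ) [Fact p.Prime]
      (v : HeightOneSpectrum (𝓞 F)) (hv : ((p : ℕ) : 𝓞 F) ∈ v.asIdeal),
      (fontainePstAdicCompletion v p hv).CyclotomicPowersLabelledWeights :=
  fun _ _ _ p _ v hv => cyclotomicPowersLabelledWeights_fontainePstAdicCompletion h v p hv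

/-- **Clause (F12) of the pin at every place `v ∣ p` of every number field, under
`FontaineDatumExists`**: for THE pinned datum `fontainePstAdicCompletion v p hv` of the summit,
whenever `ℚ_p → F_v` is surjective for its `ℚ_p`-structure, crystalline framed representations of
`Γ_{F_v}` have `det = ε^{-Σ HT_τ}` on `absInertia (F_v)`.
[cite: BrinonConrad2009, Prop. 8.3.4 and Prop. 9.1.11] [cite: Conrad2011LiftingGlobal, Appendix B, Prop. B.4] -/
theorem FontaineDatumExists.pinnedCrystallineDetOnInertia (h : FontaineDatumExists) :
    ∀ (F : Type) [Field F] [NumberField F] (p : ℕ) [Fact p.Prime]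
      (v : HeightOneSpectrum (𝓞 F)) (hv : ((p : ℕ) : 𝓞 F) ∈ v.asIdeal),
      (fontainePstAdicCompletion v p hv).CrystallineDetOnInertia :=
  fun _ _ _ p _ v hv => crystallineDetOnInertia_fontainePstAdicCompletion h v p hv

/-- **Clause (F13) of the pin at every place `v ∣ p` of every number field, under
`FontaineDatumExists`**: Fontaine–Laffaille reductions for THE pinned datum
`fontainePstAdicCompletion v p hv` (vacuous unless `ℚ_p → F_v` is surjective).
[cite: FontaineLaffaille1982, Prop. 4.4 and Thm. 5.3 (iii)] [cite: GeeHerzigLiuSavitt2017, Prop. 2.3.1] -/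
theorem FontaineDatumExists.pinnedFontaineLaffailleReductions (h : FontaineDatumExists) :
    ∀ (F : Type) [Field F] [NumberField F] (p : ℕ) [Fact p.Prime]
      (v : HeightOneSpectrum (𝓞 F)) (hv : ((p : ℕ) : 𝓞 F) ∈ v.asIdeal),
      (fontainePstAdicCompletion v p hv).FontaineLaffailleReductions :=
  fun _ _ _ p _ v hv => fontaineLaffailleReductions_fontainePstAdicCompletion h v p hv

/-- **Clause (F14) of the pin over every `ℓ`-adic field, under `FontaineDatumExists` — the body of
the named fact `GeeGeraghty2012.crystalline_of_ordinary_regular`, verbatim** (file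
`PAdicHodge/CrystallineOfOrdinaryRegular`, which imports this one and derives
`crystalline_of_ordinary_regular_of_fontaineDatumExists` from the present theorem in one line): for
every characteristic-`0` non-archimedean local field `F` with `|ℓ|_F < 1`, the canonical Artin datum,
`ρ : Γ_F →ₜ* GL_n(ℚ̄_ℓ)` and a dominant regular labelled weight `λ`, if after a change of frame `ρ` is
upper triangular with diagonal entries `χ^λ_{i+1} = ∏_τ τ(Art_F⁻¹ ·)^{-(λ_{τ,n-i} + i)}` on all of the
Weil-group inertia, then `ρ` is crystalline for THE datum `fontainePst F ℓ hℓ` (Gee–Geraghty 2012,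
Lemma 3.1.4 (3)). [cite: GeeGeraghty2012, Def. 3.1.2 and Lemma 3.1.4 (3)] -/
theorem FontaineDatumExists.isCrystallineFramed_of_ordinary_regular (h : FontaineDatumExists) :
    ∀ (F : Type) [Field F] [ValuativeRel F] [TopologicalSpace F] [IsNonarchimedeanLocalField F]
      [CharZero F] (ℓ : ℕ) [Fact ℓ.Prime] (hℓ : valuation F ℓ < 1) (n : ℕ)
      (art : LocalArtinData F), art.IsCanonical →
      ∀ (ρ : FramedGaloisRep F (PadicAlgCl ℓ) n) (wt : LabelledWeight F (PadicAlgCl ℓ) n),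
        wt.IsDominant →
        (∀ i j : Fin n, (i : ℕ) + 1 = j → ∃ τ : HodgeTateLabel F (PadicAlgCl ℓ), wt τ j < wt τ i) →
        (∃ g : GL (Fin n) (PadicAlgCl ℓ), FramedRep.IsUpperTriangular (ρ.conj g) ∧
          ∀ w ∈ WeilGroup.inertia F, ∀ i : Fin n,
            FramedRep.diagEntry (ρ.conj g) i (WeilGroup.toAbsGalois F w) =
              (ordinaryWeightUnit wt i (art.artin w) : PadicAlgCl ℓ)) →
        (fontainePst F ℓ hℓ).IsCrystallineFramed ρ :=
  fun F _ _ _ _ _ ℓ _ hℓ _ art hart ρ wt hdom hreg hord =>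
    fontainePst_isCrystallineFramed_of_ordinary_regular (F := F) (ℓ := ℓ) h hℓ art hart ρ wt hdom
      hreg hord

end Literature.NumberTheory.PAdicHodge

end
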